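import Literature.MathematicalPhysics.PowerSystems.OscillatorNetworkTypeCounts
import Mathlib.Combinatorics.SimpleGraph.LapMatrix
import Mathlib.Combinatorics.SimpleGraph.Connectivity.Finite
import HarnessLib

/-!
# Bronski–DeVille's inertia bounds for signed graph Laplacians (Theorem 2.8, GENERAL — meshed —
# case, with the tightness clause): the TYPE of ANY fixed point of an oscillator / swing network
# lies between `c(Γ₊) − 1` and `N − c(Γ₋)`, and both ends are attained

Topic `Literature/MathematicalPhysics/PowerSystems`; namespaces `…PowerSystems.SignedLaplacian`
(§1–§3, abstract signed graphs on any finite node type), `…NonuniformKuramoto` (§4, first-order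
networks), `…ClassicalModel.LosslessSystem` (§5, swing networks). Sequel of
`TreeNetworkFixedPointIndex.lean` (the RIGID = tree case of the same theorem, whose header lists as
NOT CLAIMED exactly what is proved here: «meshed networks (`τ(Γ) > 0`: weight-dependent index, Thm
2.8's strict inequalities), the tightness clause of Thm 2.8»). Everything below is PROVED: 0
definitions, 0 named facts, 0 `sorry`, no new axiom. Reused UNCHANGED: the kernel-form
Courant–Fischer counts `NonuniformKuramoto.card_eigenvalues_{pos,nonneg,neg,nonpos}_le_of_…_on_ker`
(`CompleteKuramotoIndexTheorem.lean`, `TreeNetworkFixedPointIndex.lean`), the reference-node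
reduction `RefNode.refMinor_counts` and the root counts `countP_roots_charpoly_toDroopNetwork_auxJac`
/ `countP_roots_charpoly_phaseJac_modRotation` (`OscillatorNetworkTypeCounts.lean` and its imports),
`EigenvalueCountOnSubspaces.card_filter_eigenvalues_neg`, `KyFan.dotProduct_mulVec_eq_sum_eigen` /
`dotProduct_self_eq_sum_sq`, and Mathlib's graph Laplacian API (`SimpleGraph.lapMatrix`,
`lapMatrix_mulVec_eq_zero_iff_forall_adj`, `card_connectedComponent_eq_finrank_ker_toLin'_lapMatrix`,
`IsHermitian.rank_eq_card_non_zero_eigs`).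

SOURCE (held LaTeX, read on the page: `lit read arxiv:1303.0718`). J. C. Bronski, L. DeVille,
*Spectral theory for dynamics on graphs containing attractive and repulsive interactions*, SIAM J.
Appl. Math. **74** (2014) 83–105 [BronskiDeVille2014]. §1 eq. (Laplacian) `ℒ(Γ)ᵢⱼ = γᵢⱼ`
(`i ≠ j`), `−Σ_{k≠i}γᵢₖ` (`i = j`) (p0003 L18–L30); eqs. (network) `ẋᵢ = ωᵢ + Σⱼ φᵢⱼ(xⱼ − xᵢ)`,
(J) its Jacobian «a graph Laplacian» with `γᵢⱼ = φ′ᵢⱼ(xⱼ − xᵢ)` (p0003 L45–L69). §2.1 Definition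
2.1: `Γ₊` (resp. `Γ₋`) = same vertex set with the edges of positive (resp. negative) weight, `c(·)`
= number of components, flexibility `τ(Γ) = |V(Γ)| − c(Γ₋) − c(Γ₊) + 1`, «If `τ(Γ) = 0`, then we
say that `Γ` is rigid», indices `(n₋, n₀, n₊)` (p0006 L9–L50); Remark 2.2 «`ℒ(Γ)𝟙 = 0` … `n₀(Γ) ≥
1` … if all the weights `γᵢⱼ ≥ 0` … negative semi-definite, with `n₀(Γ) = c(Γ)`» (p0006 L52–L60);
**Lemma 2.3** «If `Γ` is connected … `c(Γ₊) + c(Γ₋) ≤ N + 1`» (p0006 L62–L75). §2.2 **Theorem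
2.8** «Let `Γ` be a connected signed graph, and `n₋(Γ), n₀(Γ), n₊(Γ)` be the number of negative,
zero, and positive eigenvalues respectively. Then for any choice of weights one has the following
inequalities: `c(Γ₊) − 1 ≤ n₊(Γ) ≤ N − c(Γ₋)`, `c(Γ₋) − 1 ≤ n₋(Γ) ≤ N − c(Γ₊)`, `1 ≤ n₀(Γ) ≤ N + 2
− c(Γ₋) − c(Γ₊)`. Further these bounds are tight: for any given graph there exist open sets of
weights giving maximal number of negative eigenvalues `n₊(Γ) = c(Γ₊) − 1`, `n₋(Γ) = N − c(Γ₊)`,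
`n₀(Γ) = 1` as well as open sets of weights giving the maximal number of positive eigenvalues
`n₊(Γ) = N − c(Γ₋)`, `n₋(Γ) = c(Γ₋) − 1`, `n₀(Γ) = 1`» (p0007 L35–L65); **Remarks 2.9** «in each
inequality … the difference between the upper and lower bound is exactly the flexibility … For rigid
graphs there are no eigenvalue crossings and the index is fixed regardless of the choice of weights …
a necessary condition for stability of a phase-locked state is that between any two oscillators there
exists a path such `φ′ᵢⱼ(xᵢ − xⱼ) > 0` for all edges on the path» (p0007 L66–L90); Definition
2.10 the homotopy `γᵢⱼ(t) = γᵢⱼ` (`γᵢⱼ > 0`), `t·γᵢⱼ` (`γᵢⱼ < 0`), «`Γ(t) = Γ₊ + tΓ₋`» (p0007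
L96–L106); §3.2 Theorem 3.9 (large-`t` asymptotics, `N − c(Γ₋)` / `c(Γ₋) − 1` / one zero) (p0013).
Restated as Remark 4 of W. Chen, D. Wang, J. Liu, Y. Chen, S. Z. Khong, T. Başar, K. H. Johansson,
L. Qiu, IEEE TAC 66 (2021) (`lit read arxiv:2009.03581` p0013 L72–L82, «inertia bounds first
reported in [la1]»). Type = root count of the reduced system: H.-D. Chiang et al. [Chiang1995] §6
Thm 6.1 / 6.7; for the first-order reading W. Chen et al. IFAC 2016 [ChenWangLiuBasarJohanssonQiu2016]
§5 («`J(θ₀)` has exactly the same number of positive, negative, and zero eigenvalues as `−L(θ₀)`»).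

RENDERING. Weights `w : ι → ι → ℝ` symmetric (the diagonal is immaterial); `W` any real symmetric
matrix with `xᵀWx = −Σᵢxᵢ Σⱼ wᵢⱼ(xᵢ − xⱼ)` (`= ℒ(Γ)`, which exists: `exists_matrix_form`);
`Γ₊`, `Γ₋` are taken as HYPOTHESES on two `SimpleGraph ι` — `Gp.Adj i j ↔ i ≠ j ∧ 0 < w i j`,
`Gm.Adj i j ↔ i ≠ j ∧ w i j < 0` — so that no definition is introduced; «`Γ` connected» is
`(Gp ⊔ Gm).Connected`; `c(·) = Nat.card (·).ConnectedComponent`; `N = Fintype.card ι`; the bounds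
are stated in `ℕ` (truncated subtraction, harmless: every printed bound is non-negative).

WHAT IS PROVED.
* §1 `form_eq_half_sum_sq`, `form_eq_posPart_sub_negPart` (`ℒ(Γ) = ℒ(Γ₊) + ℒ(Γ₋)`),
  `exists_matrix_form`, `finrank_range_lapMatrix_add_card` (`rank ℒ(G) + c(G) = N`, Remark 2.2).
* §2 THE BOUNDS: `card_eigenvalues_pos_le` (`n₊ ≤ N − c(Γ₋)`), `card_eigenvalues_neg_le`,
  `card_eigenvalues_nonpos_le` (`⇔ c(Γ₊) − 1 ≤ n₊`, connected), `card_eigenvalues_nonneg_le`,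
  `exists_eigenvalues_eq_zero` / `one_le_card_eigenvalues_zero` (`ℒ𝟙 = 0` from the form alone),
  ★★★ **`inertia_bounds`** (the three printed lines), **`card_components_add_le`** (LEMMA 2.3, purely
  combinatorial conclusion, spectral proof), ★ `pos_connected_of_card_pos_eq_zero` (Remarks 2.9: no
  positive eigenvalue ⇒ `Γ₊` connected), ★★ **`rigid_inertia`** (`c(Γ₊) + c(Γ₋) = N + 1` ⇒
  `(n₊, n₀, n₋) = (c(Γ₊) − 1, 1, c(Γ₋) − 1)` for every choice of weights).
* §3 TIGHTNESS: `card_eigenvalues_lapMatrix_eq_zero` (`n₀(ℒ(G)) = c(G)` for Mathlib's Laplacian),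
  `form_homotopy` (Definition 2.10), ★★ **`inertia_eq_of_weak_repulsion`** (`∃ t₀ > 0, ∀ t ∈ (0, t₀)`:
  every carrier of `Γ(t)` has `(n₊, n₀, n₋) = (c(Γ₊) − 1, 1, N − c(Γ₊))`) and
  ★★ **`inertia_eq_of_strong_repulsion`** (`∃ t₁, ∀ t > t₁`: `(N − c(Γ₋), 1, c(Γ₋) − 1)`).
* §4 FIRST-ORDER MODEL (`Kur : NonuniformKuramoto n`, `P` symmetric, any `ω`, any topology, weights
  `Pᵢⱼcos(θᵢ − θⱼ)` at ANY `θ`): ★★★ **`inertia_bounds_neg_lap`** (the three lines for the stability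
  matrix `−L(θ)`), ★ `shortLines_connected_of_card_pos_eq_zero`, ★★★ **`type_bounds_auxJac`**
  (`Dᵢ > 0`, simple zero: `c(Γ₊) − 1 ≤ RHP roots ≤ N − c(Γ₋)`, `c(Γ₋) − 1 ≤ LHP ≤ N − c(Γ₊)`,
  axis `= 1`), ★★ **`rigid_type_auxJac`** (rigid ⇒ type `= c(Γ₊) − 1` with no simplicity
  hypothesis), ★ `type_eq_of_weak_longLines` / `type_eq_of_strong_longLines` (tightness: rescaling the
  long-line couplings by small / large `t` realises the two extreme types).
* §5 SWING MODEL (`S : ClassicalModel.LosslessSystem n 0`, `Mᵢ, Dᵢ > 0`, `C` symmetric):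
  ★★★ **`type_bounds_phaseJac`**, ★★ **`rigid_type_phaseJac`** (LHP counts shifted by `N`).

PROOF ROUTE (documented deviation). The print counts eigenvalue crossings of `ℒ(Γ(t))` through the
crossing polynomial `𝓜(Γ(t))` (matrix-tree theorem, Lemmas 2.11–2.16). Here the four inequalities are
Courant–Fischer counts in kernel form: on `ker ℒ(Γ₋)` (dimension `c(Γ₋)`, Mathlib) the form `−Q =
−Q₊` is `≤ 0` ⇒ `n₊ ≤ N − c(Γ₋)`; on `ker ℒ(Γ₊) ∩ {x_{i₀} = 0}` it equals `Q₋ > 0` for `x ≠ 0`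
(a vanishing `Q₋` makes `x` constant along `Γ₋` too, hence constant on the connected `Γ`, hence `0`)
⇒ `#{λ ≤ 0} ≤ N + 1 − c(Γ₊)`; `n₀ ≥ 1` by `ℒ𝟙 = 0` (polarisation of the form); the mirror images.
Tightness along `Γ(t)`: on the orthogonal complement of `ker ℒ(Γ₊)` (codimension `c(Γ₊)`, counted by
`rank = #{non-zero eigenvalues}`) the unweighted Laplacian form has a spectral gap `μ₁`, the positive
weights a minimum `m`, so `Q₊ ≥ mμ₁‖x‖²` while `Q₋ ≤ 2(ΣΣw⁻)‖x‖²`; for `t < mμ₁/(2ΣΣw⁻ + 1)` the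
form of `Γ(t)` is negative definite there ⇒ `#{λ ≥ 0} ≤ c(Γ₊)`, and the bounds pin the rest; the
large-`t` end is the mirror statement with `#{λ ≤ 0} ≤ c(Γ₋)` (the source's Theorem 3.9 does this by
perturbation theory). In-seat cross-check (own exact Lagrange congruence diagonalisation over `ℚ`,
plain python, `negtest/bd_thm28_check.py` in the seat folder): 400 random connected signed graphs,
`N = 2…7`: the six bounds `400/400`, rigid equality `165/165`, both tightness ends at `t = 10^{∓6}`
`400/400`.

THREE COLUMNS. CERTIFIED: kernel theorems — for exact data the two component counts `c(Γ₊)`,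
`c(Γ₋)` of an operating point bracket its type in both model tiers; rigid configurations have a
weight-independent type; the brackets are optimal over the coupling strengths. MODELLED: first-order
Kuramoto / droop oscillators (Jacobian `−D⁻¹L(θ)`) and network-reduced lossless swing machines
(Jacobian `[[0, 1], [−M⁻¹M(θ), −M⁻¹D]]`), lossless symmetric couplings. NOT CLAIMED: which value in
the bracket a given flexible (`τ > 0`) configuration takes (that needs the weights — e.g. the
effective-resistance criteria of `LongLineEffectiveResistanceCriterion.lean` for one long line, or the
conductance-matrix inertia formula of Chen et al. 2021 Thm 5, not typed), degenerate configurations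
in the type statements (`n₀ > 1`), lossy lines, structure-preserving models.
-/

noncomputable section

open Real Set Filter Topology Metric Finset Matrix
open scoped Matrix

namespace Literature.MathematicalPhysics.PowerSystems

namespace SignedLaplacian

variable {ι : Type*} [Fintype ι]

/-! ### §1. The signed form, its positive and negative parts, and the subgraphs `Γ₊`, `Γ₋` -/

/-- The real form of a symmetric signed Laplacian is one half of the symmetric weighted sum of
squared differences: `Σᵢ xᵢ Σⱼ wᵢⱼ(xᵢ − xⱼ) = ½ΣᵢΣⱼ wᵢⱼ(xᵢ − xⱼ)²` (any finite node type; the tree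
version `laplacianForm_eq_half_sum_sq` is over `Fin n`).
[cite: BronskiDeVille2014, §1 eq. (Laplacian) and §2.1 Remark 2.2 (arXiv:1303.0718 p0003 L18–L30, p0006 L52–L60)] -/
theorem form_eq_half_sum_sq (w : ι → ι → ℝ) (hw : ∀ i j, w i j = w j i) (x : ι → ℝ) :
    ∑ i, x i * ∑ j, w i j * (x i - x j) = 1 / 2 * ∑ i, ∑ j, w i j * (x i - x j) ^ 2 := by
  have h1 : ∑ i, x i * ∑ j, w i j * (x i - x j) = ∑ i, ∑ j, w i j * (x i * (x i - x j)) := by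
    refine Finset.sum_congr rfl fun i _ => ?_
    rw [Finset.mul_sum]
    exact Finset.sum_congr rfl fun j _ => by ring
  have h2 : ∑ i, ∑ j, w i j * (x i * (x i - x j)) = ∑ i, ∑ j, w i j * (x j * (x j - x i)) := by
    rw [Finset.sum_comm]
    exact Finset.sum_congr rfl fun i _ => Finset.sum_congr rfl fun j _ => by rw [hw]
  have h3 : ∑ i, ∑ j, w i j * (x i - x j) ^ 2
      = ∑ i, ∑ j, w i j * (x i * (x i - x j)) + ∑ i, ∑ j, w i j * (x j * (x j - x i)) := by
    rw [← Finset.sum_add_distrib]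
    refine Finset.sum_congr rfl fun i _ => ?_
    rw [← Finset.sum_add_distrib]
    exact Finset.sum_congr rfl fun j _ => by ring
  rw [h1, h3, ← h2]
  ring

/-- The signed form splits into its attractive and repulsive parts,
`Σᵢxᵢ Σⱼ wᵢⱼ(xᵢ − xⱼ) = ½ΣΣ max(wᵢⱼ,0)(xᵢ − xⱼ)² − ½ΣΣ max(−wᵢⱼ,0)(xᵢ − xⱼ)²`: the Laplacian of
`Γ` is the sum of those of `Γ₊` and `Γ₋` («`(Γ₊)ᵢⱼ = max(γᵢⱼ,0)`, `(Γ₋)ᵢⱼ = min(γᵢⱼ,0)`»).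
[cite: BronskiDeVille2014, §2.1 Definition 2.1 (arXiv:1303.0718 p0006 L9–L25)] -/
theorem form_eq_posPart_sub_negPart (w : ι → ι → ℝ) (hw : ∀ i j, w i j = w j i) (x : ι → ℝ) :
    ∑ i, x i * ∑ j, w i j * (x i - x j)
      = 1 / 2 * ∑ i, ∑ j, max (w i j) 0 * (x i - x j) ^ 2
        - 1 / 2 * ∑ i, ∑ j, max (-(w i j)) 0 * (x i - x j) ^ 2 := by
  rw [form_eq_half_sum_sq w hw x, ← mul_sub, ← Finset.sum_sub_distrib]
  congr 1
  refine Finset.sum_congr rfl fun i _ => ?_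
  rw [← Finset.sum_sub_distrib]
  refine Finset.sum_congr rfl fun j _ => ?_
  have : max (w i j) 0 - max (-(w i j)) 0 = w i j := by
    rcases le_total 0 (w i j) with h | h
    · rw [max_eq_left h, max_eq_right (by linarith), sub_zero]
    · rw [max_eq_right h, max_eq_left (by linarith)]; ring
  rw [← sub_mul, this]

/-- **Every symmetric weight family is carried by a real symmetric matrix** — the signed Laplacian
itself, `ℒ(Γ)ᵢⱼ = γᵢⱼ` (`i ≠ j`), `ℒ(Γ)ᵢᵢ = −Σ_{k≠i} γᵢₖ`, has `xᵀℒx = −Σᵢxᵢ Σⱼ γᵢⱼ(xᵢ − xⱼ)` — so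
the matrix-free statements below are statements about `ℒ(Γ)`.
[cite: BronskiDeVille2014, §1 eq. (Laplacian) (arXiv:1303.0718 p0003 L18–L30)] -/
theorem exists_matrix_form [DecidableEq ι] (w : ι → ι → ℝ) (hw : ∀ i j, w i j = w j i) :
    ∃ W : Matrix ι ι ℝ, W.IsHermitian
      ∧ ∀ x : ι → ℝ, x ⬝ᵥ W *ᵥ x = -∑ i, x i * ∑ j, w i j * (x i - x j) := by
  classical
  set W : Matrix ι ι ℝ := Matrix.of fun i j => (if i = j then -∑ k, w i k else 0) + w i j with hWdef
  refine ⟨W, ?_, fun x => ?_⟩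
  · rw [Matrix.IsHermitian, conjTranspose_eq_transpose_of_trivial]
    ext i j
    simp only [hWdef, transpose_apply, of_apply]
    by_cases h : i = j
    · subst h; rfl
    · rw [if_neg h, if_neg (Ne.symm h), hw]
  · have hrow : ∀ i, (W *ᵥ x) i = -∑ j, w i j * (x i - x j) := by
      intro i
      change ∑ j, ((if i = j then -∑ k, w i k else 0) + w i j) * x j = _
      have h1 : ∀ j, ((if i = j then -∑ k, w i k else 0) + w i j) * x j
          = (if i = j then (-∑ k, w i k) * x j else 0) + w i j * x j := by
        intro j; split_ifs <;> ring
      rw [Finset.sum_congr rfl (fun j _ => h1 j), Finset.sum_add_distrib, Finset.sum_ite_eq,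
        if_pos (Finset.mem_univ _)]
      have h2 : ∑ j, w i j * (x i - x j) = (∑ j, w i j) * x i - ∑ j, w i j * x j := by
        rw [Finset.sum_mul, ← Finset.sum_sub_distrib]
        exact Finset.sum_congr rfl fun j _ => by ring
      rw [h2]; ring
    calc x ⬝ᵥ W *ᵥ x = ∑ i, x i * (W *ᵥ x) i := rfl
      _ = ∑ i, x i * -∑ j, w i j * (x i - x j) := Finset.sum_congr rfl fun i _ => by rw [hrow]
      _ = -∑ i, x i * ∑ j, w i j * (x i - x j) := by
          rw [← Finset.sum_neg_distrib]
          exact Finset.sum_congr rfl fun i _ => by ring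

/-- The signed form does not see constants: `Q(x + a𝟙) = Q(x)`. [folklore] -/
private theorem form_add_const (w : ι → ι → ℝ) (x : ι → ℝ) (a : ℝ) :
    ∑ i, (x i + a) * ∑ j, w i j * ((x i + a) - (x j + a)) - ∑ i, x i * ∑ j, w i j * (x i - x j)
      = a * ∑ i, ∑ j, w i j * (x i - x j) := by
  rw [Finset.mul_sum, ← Finset.sum_sub_distrib]
  refine Finset.sum_congr rfl fun i _ => ?_
  have : ∑ j, w i j * ((x i + a) - (x j + a)) = ∑ j, w i j * (x i - x j) :=
    Finset.sum_congr rfl fun j _ => by ring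
  rw [this]; ring

/-- For symmetric weights the double sum `ΣᵢΣⱼ wᵢⱼ(xᵢ − xⱼ)` vanishes. [folklore] -/
private theorem sum_sum_mul_sub_eq_zero (w : ι → ι → ℝ) (hw : ∀ i j, w i j = w j i) (x : ι → ℝ) :
    ∑ i, ∑ j, w i j * (x i - x j) = 0 := by
  have h : ∑ i, ∑ j, w i j * (x i - x j) = -∑ i, ∑ j, w i j * (x i - x j) := by
    conv_rhs => rw [Finset.sum_comm]
    rw [← Finset.sum_neg_distrib]
    refine Finset.sum_congr rfl fun i _ => ?_
    rw [← Finset.sum_neg_distrib]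
    exact Finset.sum_congr rfl fun j _ => by rw [hw]; ring
  linarith

/-- A symmetric sum of squares with non-negative weights is non-negative. [folklore] -/
private theorem sumSq_nonneg {a : ι → ι → ℝ} (ha : ∀ i j, 0 ≤ a i j) (x : ι → ℝ) :
    0 ≤ 1 / 2 * ∑ i, ∑ j, a i j * (x i - x j) ^ 2 :=
  mul_nonneg (by norm_num) (Finset.sum_nonneg fun i _ => Finset.sum_nonneg fun j _ =>
    mul_nonneg (ha i j) (sq_nonneg _))

/-- A sum of squares with non-negative weights vanishes iff the vector is constant along every pair
of positive weight. [folklore] -/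
private theorem sumSq_eq_zero_iff {a : ι → ι → ℝ} (ha : ∀ i j, 0 ≤ a i j) (x : ι → ℝ) :
    1 / 2 * ∑ i, ∑ j, a i j * (x i - x j) ^ 2 = 0 ↔ ∀ i j, 0 < a i j → x i = x j := by
  constructor
  · intro h i j hij
    have h0 : ∑ i, ∑ j, a i j * (x i - x j) ^ 2 = 0 := by linarith
    have hi := (Finset.sum_eq_zero_iff_of_nonneg fun i _ =>
      Finset.sum_nonneg fun j _ => mul_nonneg (ha i j) (sq_nonneg _)).1 h0 i (Finset.mem_univ _)
    have hj := (Finset.sum_eq_zero_iff_of_nonneg fun j _ =>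
      mul_nonneg (ha i j) (sq_nonneg _)).1 hi j (Finset.mem_univ _)
    rcases mul_eq_zero.1 hj with h' | h'
    · exact absurd h' hij.ne'
    · exact sub_eq_zero.1 (pow_eq_zero_iff two_ne_zero |>.1 h')
  · intro h
    have : ∑ i, ∑ j, a i j * (x i - x j) ^ 2 = 0 := by
      refine Finset.sum_eq_zero fun i _ => Finset.sum_eq_zero fun j _ => ?_
      rcases (ha i j).lt_or_eq with hij | hij
      · rw [h i j hij, sub_self, zero_pow two_ne_zero, mul_zero]
      · rw [← hij, zero_mul]
    rw [this, mul_zero]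

omit [Fintype ι] in
/-- Constancy along the edges of a graph propagates along walks. [folklore] -/
private theorem eq_of_reachable {G : SimpleGraph ι} {x : ι → ℝ}
    (h : ∀ i j, G.Adj i j → x i = x j) {i j : ι} (hr : G.Reachable i j) : x i = x j := by
  obtain ⟨p⟩ := hr
  induction p with
  | nil => rfl
  | cons hA _ ih => exact (h _ _ hA).trans ih

/-- Membership in the kernel of Mathlib's (unweighted) Laplacian of `G` is constancy along the edges
of `G`. [folklore] -/
private theorem mem_ker_lapMatrix_iff [DecidableEq ι] (G : SimpleGraph ι) [DecidableRel G.Adj]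
    (x : ι → ℝ) :
    x ∈ LinearMap.ker (Matrix.toLin' (G.lapMatrix ℝ)) ↔ ∀ i j, G.Adj i j → x i = x j := by
  rw [LinearMap.mem_ker, Matrix.toLin'_apply, SimpleGraph.lapMatrix_mulVec_eq_zero_iff_forall_adj]

/-- **The kernel of a graph Laplacian has dimension the number of connected components**, so its
range has dimension `N − c(G)` (rank–nullity): `rank ℒ(G) + c(G) = N`.
[cite: BronskiDeVille2014, §2.1 Remark 2.2 («if all the weights `γᵢⱼ ≥ 0` … `n₀(Γ) = c(Γ)` and thus `n₋ = |V(Γ)| − c(Γ)`», arXiv:1303.0718 p0006 L52–L60)] -/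
theorem finrank_range_lapMatrix_add_card [DecidableEq ι] (G : SimpleGraph ι) [DecidableRel G.Adj] :
    Module.finrank ℝ (LinearMap.range (Matrix.toLin' (G.lapMatrix ℝ)))
      + Nat.card G.ConnectedComponent = Fintype.card ι := by
  classical
  rw [Nat.card_eq_fintype_card, SimpleGraph.card_connectedComponent_eq_finrank_ker_toLin'_lapMatrix,
    LinearMap.finrank_range_add_finrank_ker, Module.finrank_fintype_fun_eq_card]

/-- The positive-part weights are constant-free on the kernel of `Γ₊`'s Laplacian: if `x` is constant
along every edge of `Γ₊` then `½ΣΣ max(wᵢⱼ,0)(xᵢ − xⱼ)² = 0`. [folklore] -/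
private theorem posSumSq_eq_zero_of_const {w : ι → ι → ℝ} {Gp : SimpleGraph ι}
    (hGp : ∀ i j, Gp.Adj i j ↔ i ≠ j ∧ 0 < w i j) {x : ι → ℝ}
    (hx : ∀ i j, Gp.Adj i j → x i = x j) :
    1 / 2 * ∑ i, ∑ j, max (w i j) 0 * (x i - x j) ^ 2 = 0 := by
  refine (sumSq_eq_zero_iff (fun i j => le_max_right _ _) x).2 fun i j hij => ?_
  by_cases h : i = j
  · rw [h]
  · exact hx i j ((hGp i j).2 ⟨h, (lt_max_iff.1 hij).resolve_right (lt_irrefl 0)⟩)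

/-- If `x` is constant along every edge of `Γ₋` then `½ΣΣ max(−wᵢⱼ,0)(xᵢ − xⱼ)² = 0`. [folklore] -/
private theorem negSumSq_eq_zero_of_const {w : ι → ι → ℝ} {Gm : SimpleGraph ι}
    (hGm : ∀ i j, Gm.Adj i j ↔ i ≠ j ∧ w i j < 0) {x : ι → ℝ}
    (hx : ∀ i j, Gm.Adj i j → x i = x j) :
    1 / 2 * ∑ i, ∑ j, max (-(w i j)) 0 * (x i - x j) ^ 2 = 0 := by
  refine (sumSq_eq_zero_iff (fun i j => le_max_right _ _) x).2 fun i j hij => ?_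
  by_cases h : i = j
  · rw [h]
  · exact hx i j ((hGm i j).2 ⟨h, neg_pos.1 ((lt_max_iff.1 hij).resolve_right (lt_irrefl 0))⟩)

omit [Fintype ι] in
/-- Connectivity of `Γ = Γ₊ ∪ Γ₋`: a vector constant along the edges of `Γ₊` and of `Γ₋` is
constant. [folklore] -/
private theorem const_of_const_pos_neg {Gp Gm : SimpleGraph ι} (hconn : (Gp ⊔ Gm).Connected)
    {x : ι → ℝ} (hp : ∀ i j, Gp.Adj i j → x i = x j) (hm : ∀ i j, Gm.Adj i j → x i = x j)
    (i j : ι) : x i = x j := by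
  refine eq_of_reachable (G := Gp ⊔ Gm) (fun a b hab => ?_) (hconn.preconnected i j)
  rcases (SimpleGraph.sup_adj Gp Gm a b).1 hab with h | h
  · exact hp a b h
  · exact hm a b h

/-! ### §2. THEOREM 2.8, first part: the inertia bounds of a connected signed graph Laplacian -/

section Bounds

variable [DecidableEq ι] {w : ι → ι → ℝ} {Gp Gm : SimpleGraph ι} {W : Matrix ι ι ℝ}

/-- **`n₊(Γ) ≤ N − c(Γ₋)`.** For a real symmetric `W` carrying the signed-Laplacian form
`xᵀWx = −Σᵢxᵢ Σⱼ wᵢⱼ(xᵢ − xⱼ)` (`w` symmetric; `ℒ(Γ)` of the source, negative semi-definite for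
non-negative weights) the number of positive eigenvalues is at most `N − c(Γ₋)`, `Γ₋` the subgraph
of negatively weighted edges. [cite: BronskiDeVille2014, §2.2 Theorem 2.8, eq. (bounds) first line, upper bound (arXiv:1303.0718 p0007 L35–L45)] -/
theorem card_eigenvalues_pos_le (hw : ∀ i j, w i j = w j i)
    (hGm : ∀ i j, Gm.Adj i j ↔ i ≠ j ∧ w i j < 0) (hW : W.IsHermitian)
    (hWform : ∀ x : ι → ℝ, x ⬝ᵥ W *ᵥ x = -∑ i, x i * ∑ j, w i j * (x i - x j)) :
    (univ.filter fun i => 0 < hW.eigenvalues i).card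
      ≤ Fintype.card ι - Nat.card Gm.ConnectedComponent := by
  classical
  have hdim := finrank_range_lapMatrix_add_card Gm
  refine NonuniformKuramoto.card_eigenvalues_pos_le_of_nonpos_on_ker hW
    (Matrix.toLin' (Gm.lapMatrix ℝ)).rangeRestrict (by omega) fun x hx => ?_
  have hker : x ∈ LinearMap.ker (Matrix.toLin' (Gm.lapMatrix ℝ)) := by
    rw [← LinearMap.ker_rangeRestrict]; exact hx
  rw [mem_ker_lapMatrix_iff] at hker
  rw [hWform, form_eq_posPart_sub_negPart w hw, negSumSq_eq_zero_of_const hGm hker, sub_zero,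
    neg_nonpos]
  exact sumSq_nonneg (fun i j => le_max_right _ _) x

/-- **`n₋(Γ) ≤ N − c(Γ₊)`.** [cite: BronskiDeVille2014, §2.2 Theorem 2.8, eq. (bounds) second line, upper bound (arXiv:1303.0718 p0007 L35–L45)] -/
theorem card_eigenvalues_neg_le (hw : ∀ i j, w i j = w j i)
    (hGp : ∀ i j, Gp.Adj i j ↔ i ≠ j ∧ 0 < w i j) (hW : W.IsHermitian)
    (hWform : ∀ x : ι → ℝ, x ⬝ᵥ W *ᵥ x = -∑ i, x i * ∑ j, w i j * (x i - x j)) :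
    (univ.filter fun i => hW.eigenvalues i < 0).card
      ≤ Fintype.card ι - Nat.card Gp.ConnectedComponent := by
  classical
  have hdim := finrank_range_lapMatrix_add_card Gp
  refine NonuniformKuramoto.card_eigenvalues_neg_le_of_nonneg_on_ker hW
    (Matrix.toLin' (Gp.lapMatrix ℝ)).rangeRestrict (by omega) fun x hx => ?_
  have hker : x ∈ LinearMap.ker (Matrix.toLin' (Gp.lapMatrix ℝ)) := by
    rw [← LinearMap.ker_rangeRestrict]; exact hx
  rw [mem_ker_lapMatrix_iff] at hker
  rw [hWform, form_eq_posPart_sub_negPart w hw, posSumSq_eq_zero_of_const hGp hker, zero_sub,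
    neg_neg]
  exact sumSq_nonneg (fun i j => le_max_right _ _) x

/-- **`#{λ ≤ 0} ≤ N + 1 − c(Γ₊)` for a CONNECTED signed graph** — equivalently the lower bound
`c(Γ₊) − 1 ≤ n₊(Γ)`: on vectors constant on the components of `Γ₊` and vanishing at a node the form
`−Q = Q₋` is positive definite (a vanishing `Q₋` forces constancy on `Γ₋` as well, hence on the
connected `Γ`). [cite: BronskiDeVille2014, §2.2 Theorem 2.8, eq. (bounds) first line, lower bound, with Lemma 2.16 (arXiv:1303.0718 p0007 L35–L45, p0009 L1–L25)] -/
theorem card_eigenvalues_nonpos_le (hw : ∀ i j, w i j = w j i)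
    (hGp : ∀ i j, Gp.Adj i j ↔ i ≠ j ∧ 0 < w i j) (hGm : ∀ i j, Gm.Adj i j ↔ i ≠ j ∧ w i j < 0)
    (hconn : (Gp ⊔ Gm).Connected) (hW : W.IsHermitian)
    (hWform : ∀ x : ι → ℝ, x ⬝ᵥ W *ᵥ x = -∑ i, x i * ∑ j, w i j * (x i - x j)) :
    (univ.filter fun i => hW.eigenvalues i ≤ 0).card
      ≤ Fintype.card ι + 1 - Nat.card Gp.ConnectedComponent := by
  classical
  obtain ⟨i₀⟩ := hconn.nonempty
  have hdim := finrank_range_lapMatrix_add_card Gp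
  refine NonuniformKuramoto.card_eigenvalues_nonpos_le_of_pos_on_ker hW
    ((Matrix.toLin' (Gp.lapMatrix ℝ)).rangeRestrict.prod (LinearMap.proj i₀)) (k := _) ?_ ?_
  · rw [Module.finrank_prod, Module.finrank_self]; omega
  · intro x hx0 hx
    rw [LinearMap.prod_apply, Prod.mk_eq_zero] at hx
    have hker : x ∈ LinearMap.ker (Matrix.toLin' (Gp.lapMatrix ℝ)) := by
      rw [← LinearMap.ker_rangeRestrict]; exact hx.1
    rw [mem_ker_lapMatrix_iff] at hker
    have hxi₀ : x i₀ = 0 := hx.2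
    rw [hWform, form_eq_posPart_sub_negPart w hw, posSumSq_eq_zero_of_const hGp hker, zero_sub,
      neg_neg]
    refine (sumSq_nonneg (fun i j => le_max_right _ _) x).lt_of_ne fun h0 => hx0 ?_
    have hm : ∀ i j, Gm.Adj i j → x i = x j := by
      intro i j hij
      obtain ⟨-, hlt⟩ := (hGm i j).1 hij
      exact (sumSq_eq_zero_iff (fun i j => le_max_right _ _) x).1 h0.symm i j
        (lt_max_iff.2 (Or.inl (neg_pos.2 hlt)))
    funext j
    rw [const_of_const_pos_neg hconn hker hm j i₀, hxi₀, Pi.zero_apply]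

/-- **`#{λ ≥ 0} ≤ N + 1 − c(Γ₋)` for a connected signed graph** — equivalently
`c(Γ₋) − 1 ≤ n₋(Γ)`. [cite: BronskiDeVille2014, §2.2 Theorem 2.8, eq. (bounds) second line, lower bound, with Lemma 2.15 (arXiv:1303.0718 p0007 L35–L45, p0008 L98–L110)] -/
theorem card_eigenvalues_nonneg_le (hw : ∀ i j, w i j = w j i)
    (hGp : ∀ i j, Gp.Adj i j ↔ i ≠ j ∧ 0 < w i j) (hGm : ∀ i j, Gm.Adj i j ↔ i ≠ j ∧ w i j < 0)
    (hconn : (Gp ⊔ Gm).Connected) (hW : W.IsHermitian)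
    (hWform : ∀ x : ι → ℝ, x ⬝ᵥ W *ᵥ x = -∑ i, x i * ∑ j, w i j * (x i - x j)) :
    (univ.filter fun i => 0 ≤ hW.eigenvalues i).card
      ≤ Fintype.card ι + 1 - Nat.card Gm.ConnectedComponent := by
  classical
  obtain ⟨i₀⟩ := hconn.nonempty
  have hdim := finrank_range_lapMatrix_add_card Gm
  refine NonuniformKuramoto.card_eigenvalues_nonneg_le_of_neg_on_ker hW
    ((Matrix.toLin' (Gm.lapMatrix ℝ)).rangeRestrict.prod (LinearMap.proj i₀)) (k := _) ?_ ?_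
  · rw [Module.finrank_prod, Module.finrank_self]; omega
  · intro x hx0 hx
    rw [LinearMap.prod_apply, Prod.mk_eq_zero] at hx
    have hker : x ∈ LinearMap.ker (Matrix.toLin' (Gm.lapMatrix ℝ)) := by
      rw [← LinearMap.ker_rangeRestrict]; exact hx.1
    rw [mem_ker_lapMatrix_iff] at hker
    have hxi₀ : x i₀ = 0 := hx.2
    rw [hWform, form_eq_posPart_sub_negPart w hw, negSumSq_eq_zero_of_const hGm hker, sub_zero,
      neg_lt_zero]
    refine (sumSq_nonneg (fun i j => le_max_right _ _) x).lt_of_ne fun h0 => hx0 ?_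
    have hp : ∀ i j, Gp.Adj i j → x i = x j := by
      intro i j hij
      obtain ⟨-, hlt⟩ := (hGp i j).1 hij
      exact (sumSq_eq_zero_iff (fun i j => le_max_right _ _) x).1 h0.symm i j
        (lt_max_iff.2 (Or.inl hlt))
    funext j
    rw [const_of_const_pos_neg hconn hp hker j i₀, hxi₀, Pi.zero_apply]

/-- **`ℒ𝟙 = 0`, so `0` is an eigenvalue** (`n₀(Γ) ≥ 1`), here from the form alone (it does not see
constants; polarisation). [cite: BronskiDeVille2014, §2.1 Remark 2.2 («`ℒ(Γ)𝟙 = 0`, and one necessarily has `n₀(Γ) ≥ 1`», arXiv:1303.0718 p0006 L52–L56)] -/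
theorem exists_eigenvalues_eq_zero [Nonempty ι] (hw : ∀ i j, w i j = w j i) (hW : W.IsHermitian)
    (hWform : ∀ x : ι → ℝ, x ⬝ᵥ W *ᵥ x = -∑ i, x i * ∑ j, w i j * (x i - x j)) :
    ∃ i, hW.eigenvalues i = 0 := by
  classical
  set one : ι → ℝ := fun _ => 1 with hone_def
  have hQ1 : ∀ y : ι → ℝ, (y + one) ⬝ᵥ W *ᵥ (y + one) = y ⬝ᵥ W *ᵥ y := by
    intro y
    rw [hWform, hWform]
    have h := form_add_const w y 1
    rw [sum_sum_mul_sub_eq_zero w hw y, mul_zero, sub_eq_zero] at h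
    simp only [hone_def, Pi.add_apply]
    rw [h]
  have hQone : one ⬝ᵥ W *ᵥ one = 0 := by
    rw [hWform]
    simp [hone_def]
  have hT : Wᵀ = W := by
    have h := hW.eq
    rwa [conjTranspose_eq_transpose_of_trivial] at h
  have hsymm : ∀ y : ι → ℝ, one ⬝ᵥ W *ᵥ y = y ⬝ᵥ W *ᵥ one := by
    intro y
    calc one ⬝ᵥ W *ᵥ y = (one ᵥ* W) ⬝ᵥ y := dotProduct_mulVec _ _ _
      _ = (Wᵀ *ᵥ one) ⬝ᵥ y := by rw [mulVec_transpose]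
      _ = (W *ᵥ one) ⬝ᵥ y := by rw [hT]
      _ = y ⬝ᵥ W *ᵥ one := dotProduct_comm _ _
  have horth : ∀ y : ι → ℝ, y ⬝ᵥ W *ᵥ one = 0 := by
    intro y
    have h := hQ1 y
    rw [mulVec_add, add_dotProduct, dotProduct_add, dotProduct_add, hsymm, hQone] at h
    linarith
  have hW1 : W *ᵥ one = 0 := dotProduct_self_eq_zero.1 (horth (W *ᵥ one))
  have hone : one ≠ 0 := fun h => by
    have := congrFun h (Classical.arbitrary ι)
    simp [hone_def] at this
  have hdet : W.det = 0 := Matrix.exists_mulVec_eq_zero_iff.1 ⟨one, hone, hW1⟩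
  have hprod := hW.det_eq_prod_eigenvalues
  rw [hdet] at hprod
  simp only [RCLike.ofReal_real_eq_id, id_eq] at hprod
  obtain ⟨i, _, hi⟩ := Finset.prod_eq_zero_iff.1 hprod.symm
  exact ⟨i, hi⟩

/-- `1 ≤ n₀(Γ)`. [cite: BronskiDeVille2014, §2.2 Theorem 2.8, eq. (bounds) third line, lower bound (arXiv:1303.0718 p0007 L35–L45)] -/
theorem one_le_card_eigenvalues_zero [Nonempty ι] (hw : ∀ i j, w i j = w j i) (hW : W.IsHermitian)
    (hWform : ∀ x : ι → ℝ, x ⬝ᵥ W *ᵥ x = -∑ i, x i * ∑ j, w i j * (x i - x j)) :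
    1 ≤ (univ.filter fun i => hW.eigenvalues i = 0).card := by
  obtain ⟨i, hi⟩ := exists_eigenvalues_eq_zero hw hW hWform
  exact Finset.card_pos.2 ⟨i, Finset.mem_filter.2 ⟨Finset.mem_univ _, hi⟩⟩

/-- The three eigenvalue counts of a real symmetric matrix add up to `N`. [folklore] -/
private theorem card_pos_add_card_zero_add_card_neg (hW : W.IsHermitian) :
    (univ.filter fun i => 0 < hW.eigenvalues i).card
      + (univ.filter fun i => hW.eigenvalues i = 0).card
      + (univ.filter fun i => hW.eigenvalues i < 0).card = Fintype.card ι := by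
  rw [← Finset.card_union_of_disjoint, ← Finset.card_union_of_disjoint]
  · rw [← Finset.card_univ]
    congr 1
    ext i
    simp only [Finset.mem_union, Finset.mem_filter, Finset.mem_univ, true_and, iff_true]
    rcases lt_trichotomy 0 (hW.eigenvalues i) with h | h | h
    · exact Or.inl (Or.inl h)
    · exact Or.inl (Or.inr h.symm)
    · exact Or.inr h
  · rw [Finset.disjoint_left]
    intro i h1 h2
    simp only [Finset.mem_union, Finset.mem_filter, Finset.mem_univ, true_and] at h1 h2
    rcases h1 with h1 | h1 <;> linarith
  · rw [Finset.disjoint_left]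
    intro i h1 h2
    simp only [Finset.mem_filter, Finset.mem_univ, true_and] at h1 h2
    linarith

/-- `#{λ ≤ 0} = n₀ + n₋` and `#{λ ≥ 0} = n₊ + n₀`. [folklore] -/
private theorem card_nonpos_eq (hW : W.IsHermitian) :
    (univ.filter fun i => hW.eigenvalues i ≤ 0).card
      = (univ.filter fun i => hW.eigenvalues i = 0).card
        + (univ.filter fun i => hW.eigenvalues i < 0).card := by
  rw [← Finset.card_union_of_disjoint]
  · congr 1
    ext i
    simp only [Finset.mem_union, Finset.mem_filter, Finset.mem_univ, true_and]
    constructor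
    · intro h
      rcases h.lt_or_eq with h | h
      · exact Or.inr h
      · exact Or.inl h
    · rintro (h | h)
      · exact h.le
      · exact h.le
  · rw [Finset.disjoint_left]
    intro i h1 h2
    simp only [Finset.mem_filter, Finset.mem_univ, true_and] at h1 h2
    linarith

/-- `#{λ ≥ 0} = n₊ + n₀`. [folklore] -/
private theorem card_nonneg_eq (hW : W.IsHermitian) :
    (univ.filter fun i => 0 ≤ hW.eigenvalues i).card
      = (univ.filter fun i => 0 < hW.eigenvalues i).card
        + (univ.filter fun i => hW.eigenvalues i = 0).card := by
  rw [← Finset.card_union_of_disjoint]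
  · congr 1
    ext i
    simp only [Finset.mem_union, Finset.mem_filter, Finset.mem_univ, true_and]
    constructor
    · intro h
      rcases h.lt_or_eq with h | h
      · exact Or.inl h
      · exact Or.inr h.symm
    · rintro (h | h)
      · exact h.le
      · exact h.ge
  · rw [Finset.disjoint_left]
    intro i h1 h2
    simp only [Finset.mem_filter, Finset.mem_univ, true_and] at h1 h2
    linarith

/-- ★★★ **BRONSKI–DeVILLE THEOREM 2.8 (the inertia bounds).** «Let `Γ` be a connected signed graph,
and `n₋(Γ), n₀(Γ), n₊(Γ)` be the number of negative, zero, and positive eigenvalues respectively.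
Then for any choice of weights one has the following inequalities:
`c(Γ₊) − 1 ≤ n₊(Γ) ≤ N − c(Γ₋)`, `c(Γ₋) − 1 ≤ n₋(Γ) ≤ N − c(Γ₊)`,
`1 ≤ n₀(Γ) ≤ N + 2 − c(Γ₋) − c(Γ₊)`.» Here `W` is any real symmetric matrix carrying the signed
form `xᵀWx = −Σᵢxᵢ Σⱼ wᵢⱼ(xᵢ − xⱼ)` (`w` symmetric; `= ℒ(Γ)` of eq. (Laplacian), the diagonal of `w`
is immaterial), `Γ₊` / `Γ₋` are the graphs on the node set whose edges are the pairs of positive /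
negative weight (Definition 2.1), `c(·) = Nat.card` of connected components, `Γ = Γ₊ ∪ Γ₋` connected.
(In each line the gap between the bounds is the flexibility `τ(Γ) = N + 1 − c(Γ₋) − c(Γ₊)`,
Remarks 2.9.) [cite: BronskiDeVille2014, §2.1 Definition 2.1 and §2.2 Theorem 2.8 eq. (bounds) with Remarks 2.9 (arXiv:1303.0718 p0006 L9–L50, p0007 L35–L75)] -/
theorem inertia_bounds (hw : ∀ i j, w i j = w j i)
    (hGp : ∀ i j, Gp.Adj i j ↔ i ≠ j ∧ 0 < w i j) (hGm : ∀ i j, Gm.Adj i j ↔ i ≠ j ∧ w i j < 0)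
    (hconn : (Gp ⊔ Gm).Connected) (hW : W.IsHermitian)
    (hWform : ∀ x : ι → ℝ, x ⬝ᵥ W *ᵥ x = -∑ i, x i * ∑ j, w i j * (x i - x j)) :
    (Nat.card Gp.ConnectedComponent - 1 ≤ (univ.filter fun i => 0 < hW.eigenvalues i).card
        ∧ (univ.filter fun i => 0 < hW.eigenvalues i).card
            ≤ Fintype.card ι - Nat.card Gm.ConnectedComponent)
      ∧ (Nat.card Gm.ConnectedComponent - 1 ≤ (univ.filter fun i => hW.eigenvalues i < 0).card
        ∧ (univ.filter fun i => hW.eigenvalues i < 0).card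
            ≤ Fintype.card ι - Nat.card Gp.ConnectedComponent)
      ∧ (1 ≤ (univ.filter fun i => hW.eigenvalues i = 0).card
        ∧ (univ.filter fun i => hW.eigenvalues i = 0).card
            ≤ Fintype.card ι + 2 - Nat.card Gm.ConnectedComponent
              - Nat.card Gp.ConnectedComponent) := by
  classical
  haveI := hconn.nonempty
  have hP := card_eigenvalues_pos_le hw hGm hW hWform
  have hN := card_eigenvalues_neg_le hw hGp hW hWform
  have hNP := card_eigenvalues_nonpos_le hw hGp hGm hconn hW hWform
  have hNN := card_eigenvalues_nonneg_le hw hGp hGm hconn hW hWform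
  have h0 := one_le_card_eigenvalues_zero hw hW hWform
  have htot := card_pos_add_card_zero_add_card_neg hW
  rw [card_nonpos_eq hW] at hNP
  rw [card_nonneg_eq hW] at hNN
  have hcp := finrank_range_lapMatrix_add_card Gp
  have hcm := finrank_range_lapMatrix_add_card Gm
  omega

/-- **LEMMA 2.3 (the flexibility is non-negative):** «If `Γ` is connected, writing `|V(Γ)| = N`
gives `c(Γ₊) + c(Γ₋) ≤ N + 1`» — for EVERY symmetric weight family whose graphs of positive and of
negative pairs have a connected union (the source proves it by lifting a spanning tree of the quotient
graph; here it drops out of the two lower bounds `c(Γ₊) − 1 ≤ n₊`, `c(Γ₋) − 1 ≤ n₋` and `n₀ ≥ 1`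
for the signed Laplacian `ℒ(Γ)`). [cite: BronskiDeVille2014, §2.1 Lemma 2.3 (arXiv:1303.0718 p0006 L62–L75)] -/
theorem card_components_add_le (hw : ∀ i j, w i j = w j i)
    (hGp : ∀ i j, Gp.Adj i j ↔ i ≠ j ∧ 0 < w i j) (hGm : ∀ i j, Gm.Adj i j ↔ i ≠ j ∧ w i j < 0)
    (hconn : (Gp ⊔ Gm).Connected) :
    Nat.card Gp.ConnectedComponent + Nat.card Gm.ConnectedComponent ≤ Fintype.card ι + 1 := by
  classical
  haveI := hconn.nonempty
  obtain ⟨W, hW, hWform⟩ := exists_matrix_form w hw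
  obtain ⟨⟨h1, -⟩, ⟨h3, -⟩, ⟨h5, -⟩⟩ := inertia_bounds hw hGp hGm hconn hW hWform
  have htot := card_pos_add_card_zero_add_card_neg hW
  omega

/-- ★ **THE NETWORK NECESSARY CONDITION** («a necessary condition for stability of a phase-locked
state is that between any two oscillators there exists a path such `φ′ᵢⱼ(xᵢ − xⱼ) > 0` for all
edges on the path»): if `ℒ(Γ)` has NO positive eigenvalue then `Γ₊` is connected (`c(Γ₊) − 1 ≤
n₊ = 0`). The tree's `KuramotoCutsetStabilityNecessity.lean` has the cut-set form of the same fact.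
[cite: BronskiDeVille2014, §2.2 Remarks 2.9 (arXiv:1303.0718 p0007 L82–L90); DoBoccalettiGross2012, §III (spanning-tree criterion)] -/
theorem pos_connected_of_card_pos_eq_zero (hw : ∀ i j, w i j = w j i)
    (hGp : ∀ i j, Gp.Adj i j ↔ i ≠ j ∧ 0 < w i j) (hGm : ∀ i j, Gm.Adj i j ↔ i ≠ j ∧ w i j < 0)
    (hconn : (Gp ⊔ Gm).Connected) (hW : W.IsHermitian)
    (hWform : ∀ x : ι → ℝ, x ⬝ᵥ W *ᵥ x = -∑ i, x i * ∑ j, w i j * (x i - x j))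
    (hstable : (univ.filter fun i => 0 < hW.eigenvalues i).card = 0) : Gp.Connected := by
  classical
  haveI := hconn.nonempty
  obtain ⟨⟨h1, -⟩, -, -⟩ := inertia_bounds hw hGp hGm hconn hW hWform
  have hle : Nat.card Gp.ConnectedComponent ≤ 1 := by omega
  haveI : Subsingleton Gp.ConnectedComponent := (Finite.card_le_one_iff_subsingleton).1 hle
  exact ⟨fun u v => SimpleGraph.ConnectedComponent.exact (Subsingleton.elim _ _)⟩

/-- ★★ **RIGID GRAPHS (`τ(Γ) = 0`, i.e. `c(Γ₊) + c(Γ₋) = N + 1`): the index is fixed regardless of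
the weights** — `n₊ = c(Γ₊) − 1 = N − c(Γ₋)`, `n₋ = c(Γ₋) − 1 = N − c(Γ₊)`, `n₀ = 1`. («For rigid
graphs there are no eigenvalue crossings and the index is fixed regardless of the choice of weights.»
Trees are the case `c(Γ₊) = N − #E₊`, `c(Γ₋) = N − #E₋` of `TreeNetworkFixedPointIndex.lean`.)
[cite: BronskiDeVille2014, §2.1 Definition 2.1 («If `τ(Γ) = 0`, then we say that `Γ` is rigid») and §2.2 Remarks 2.9 (arXiv:1303.0718 p0006 L35–L40, p0007 L66–L75)] -/
theorem rigid_inertia (hw : ∀ i j, w i j = w j i)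
    (hGp : ∀ i j, Gp.Adj i j ↔ i ≠ j ∧ 0 < w i j) (hGm : ∀ i j, Gm.Adj i j ↔ i ≠ j ∧ w i j < 0)
    (hconn : (Gp ⊔ Gm).Connected)
    (hrigid : Nat.card Gp.ConnectedComponent + Nat.card Gm.ConnectedComponent = Fintype.card ι + 1)
    (hW : W.IsHermitian)
    (hWform : ∀ x : ι → ℝ, x ⬝ᵥ W *ᵥ x = -∑ i, x i * ∑ j, w i j * (x i - x j)) :
    (univ.filter fun i => 0 < hW.eigenvalues i).card = Nat.card Gp.ConnectedComponent - 1
      ∧ (univ.filter fun i => hW.eigenvalues i = 0).card = 1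
      ∧ (univ.filter fun i => hW.eigenvalues i < 0).card = Nat.card Gm.ConnectedComponent - 1 := by
  obtain ⟨⟨h1, h2⟩, ⟨h3, h4⟩, ⟨h5, h6⟩⟩ := inertia_bounds hw hGp hGm hconn hW hWform
  have htot := card_pos_add_card_zero_add_card_neg hW
  omega

end Bounds

/-! ### §3. THEOREM 2.8, second part: the bounds are TIGHT — attained along the homotopy
`Γ(t) = Γ₊ + tΓ₋` (Definition 2.10) for `t` small (maximal `n₋`) and for `t` large (maximal `n₊`) -/

section Tight

variable [DecidableEq ι] {w : ι → ι → ℝ} {Gp Gm : SimpleGraph ι}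

/-- The number of zero eigenvalues of a graph Laplacian is the number of connected components.
[cite: BronskiDeVille2014, §2.1 Remark 2.2 (`n₀(Γ) = c(Γ)` for non-negative weights, arXiv:1303.0718 p0006 L52–L60)] -/
theorem card_eigenvalues_lapMatrix_eq_zero (G : SimpleGraph ι) [DecidableRel G.Adj] :
    Fintype.card {k // (SimpleGraph.isHermitian_lapMatrix ℝ G).eigenvalues k = 0}
      = Nat.card G.ConnectedComponent := by
  classical
  have hrank := (SimpleGraph.isHermitian_lapMatrix ℝ G).rank_eq_card_non_zero_eigs
  have hdim := finrank_range_lapMatrix_add_card G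
  have hr : (G.lapMatrix ℝ).rank
      = Module.finrank ℝ (LinearMap.range (Matrix.toLin' (G.lapMatrix ℝ))) := by
    rw [Matrix.rank, Matrix.toLin'_apply']
  rw [Fintype.card_subtype] at hrank ⊢
  have hc : (univ.filter fun k => (SimpleGraph.isHermitian_lapMatrix ℝ G).eigenvalues k = 0).card
      + (univ.filter fun k => (SimpleGraph.isHermitian_lapMatrix ℝ G).eigenvalues k ≠ 0).card
      = Fintype.card ι := by
    rw [← Finset.card_univ]
    exact Finset.card_filter_add_card_filter_not _
  omega

omit [DecidableEq ι] in
/-- An upper bound for a non-negative sum of squares by the Euclidean norm: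
`½ΣΣ cᵢⱼ(xᵢ − xⱼ)² ≤ 2(ΣΣ cᵢⱼ)·(x ⬝ x)`. [folklore] -/
private theorem sumSq_le {c : ι → ι → ℝ} (hc : ∀ i j, 0 ≤ c i j) (x : ι → ℝ) :
    1 / 2 * ∑ i, ∑ j, c i j * (x i - x j) ^ 2 ≤ 2 * (∑ i, ∑ j, c i j) * (x ⬝ᵥ x) := by
  have hsq : ∀ i, x i ^ 2 ≤ x ⬝ᵥ x := by
    intro i
    have : x ⬝ᵥ x = ∑ k, x k ^ 2 := by
      simp only [dotProduct, sq]
    rw [this]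
    exact Finset.single_le_sum (f := fun k => x k ^ 2) (fun k _ => sq_nonneg (x k))
      (Finset.mem_univ i)
  have hterm : ∀ i j, c i j * (x i - x j) ^ 2 ≤ c i j * (4 * (x ⬝ᵥ x)) := by
    intro i j
    refine mul_le_mul_of_nonneg_left ?_ (hc i j)
    nlinarith [hsq i, hsq j, sq_nonneg (x i + x j)]
  calc 1 / 2 * ∑ i, ∑ j, c i j * (x i - x j) ^ 2
      ≤ 1 / 2 * ∑ i, ∑ j, c i j * (4 * (x ⬝ᵥ x)) := by
        refine mul_le_mul_of_nonneg_left ?_ (by norm_num)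
        exact Finset.sum_le_sum fun i _ => Finset.sum_le_sum fun j _ => hterm i j
    _ = 2 * (∑ i, ∑ j, c i j) * (x ⬝ᵥ x) := by
        have h : ∑ i, ∑ j, c i j * (4 * (x ⬝ᵥ x)) = (∑ i, ∑ j, c i j) * (4 * (x ⬝ᵥ x)) := by
          rw [Finset.sum_mul]
          exact Finset.sum_congr rfl fun i _ => by rw [Finset.sum_mul]
        rw [h]; ring

/-- **Spectral gap of `Γ₊` on the complement of its Laplacian kernel**: there is `μ > 0` with
`μ‖x‖² ≤ ½ΣΣ max(aᵢⱼ,0)(xᵢ − xⱼ)²` for every `x` orthogonal to the zero-eigenvectors of the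
(unweighted) Laplacian of the graph `G` of positively weighted pairs (minimum positive weight times the
smallest non-zero Laplacian eigenvalue). [folklore] -/
private theorem exists_gap (G : SimpleGraph ι) [DecidableRel G.Adj] (a : ι → ι → ℝ)
    (hGa : ∀ i j, G.Adj i j → 0 < a i j) :
    ∃ μ : ℝ, 0 < μ ∧ ∀ x : ι → ℝ,
      (∀ k, (SimpleGraph.isHermitian_lapMatrix ℝ G).eigenvalues k = 0 →
        ((SimpleGraph.isHermitian_lapMatrix ℝ G).eigenvectorBasis k).ofLp ⬝ᵥ x = 0) →
      μ * (x ⬝ᵥ x) ≤ 1 / 2 * ∑ i, ∑ j, max (a i j) 0 * (x i - x j) ^ 2 := by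
  classical
  set hM := SimpleGraph.isHermitian_lapMatrix ℝ G with hM_def
  -- (1) a uniform positive lower bound `m` for the weights on the edges of `G`
  obtain ⟨m, hm0, hm⟩ : ∃ m : ℝ, 0 < m ∧ ∀ i j, G.Adj i j → m ≤ a i j := by
    let E := (Finset.univ ×ˢ (Finset.univ : Finset ι)).filter fun p : ι × ι => G.Adj p.1 p.2
    by_cases hE : E.Nonempty
    · obtain ⟨p, hp, hpeq⟩ := Finset.exists_mem_eq_inf' hE (fun p : ι × ι => a p.1 p.2)
      refine ⟨E.inf' hE (fun p : ι × ι => a p.1 p.2), ?_, fun i j hij => ?_⟩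
      · rw [hpeq]
        exact hGa p.1 p.2 (Finset.mem_filter.1 hp).2
      · have hmem : (i, j) ∈ E :=
          Finset.mem_filter.2 ⟨Finset.mem_product.2 ⟨Finset.mem_univ _, Finset.mem_univ _⟩, hij⟩
        exact Finset.inf'_le (s := E) (f := fun p : ι × ι => a p.1 p.2) hmem
    · refine ⟨1, one_pos, fun i j hij => ?_⟩
      exact absurd ⟨(i, j), Finset.mem_filter.2
        ⟨Finset.mem_product.2 ⟨Finset.mem_univ _, Finset.mem_univ _⟩, hij⟩⟩ hE
  -- (2) the smallest non-zero Laplacian eigenvalue `μ₁`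
  have hnn : ∀ k, 0 ≤ hM.eigenvalues k :=
    fun k => (SimpleGraph.posSemidef_lapMatrix ℝ G).eigenvalues_nonneg k
  obtain ⟨μ₁, hμ₁0, hμ₁⟩ : ∃ μ₁ : ℝ, 0 < μ₁ ∧ ∀ k, hM.eigenvalues k ≠ 0 → μ₁ ≤ hM.eigenvalues k := by
    let P := Finset.univ.filter fun k => hM.eigenvalues k ≠ 0
    by_cases hP : P.Nonempty
    · obtain ⟨k, hk, hkeq⟩ := Finset.exists_mem_eq_inf' hP hM.eigenvalues
      refine ⟨P.inf' hP hM.eigenvalues, ?_, fun k hk => ?_⟩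
      · rw [hkeq]
        exact (hnn k).lt_of_ne (Ne.symm (Finset.mem_filter.1 hk).2)
      · have hmem : k ∈ P := Finset.mem_filter.2 ⟨Finset.mem_univ k, hk⟩
        exact Finset.inf'_le (s := P) (f := hM.eigenvalues) hmem
    · refine ⟨1, one_pos, fun k hk => ?_⟩
      exact absurd ⟨k, Finset.mem_filter.2 ⟨Finset.mem_univ _, hk⟩⟩ hP
  refine ⟨m * μ₁, mul_pos hm0 hμ₁0, fun x hx => ?_⟩
  -- (3) `xᵀ M x ≥ μ₁ ‖x‖²` on the orthogonal complement of the kernel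
  have hMx : μ₁ * (x ⬝ᵥ x) ≤ x ⬝ᵥ G.lapMatrix ℝ *ᵥ x := by
    rw [Literature.Analysis.Matrix.KyFan.dotProduct_mulVec_eq_sum_eigen hM x,
      Literature.Analysis.Matrix.KyFan.dotProduct_self_eq_sum_sq hM x, Finset.mul_sum]
    refine Finset.sum_le_sum fun k _ => ?_
    by_cases hk : hM.eigenvalues k = 0
    · rw [hx k hk]; simp [hk]
    · exact mul_le_mul_of_nonneg_right (hμ₁ k hk) (sq_nonneg _)
  -- (4) the unweighted form is dominated by `(1/m)` times the weighted one
  have hform : x ⬝ᵥ G.lapMatrix ℝ *ᵥ x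
      = (∑ i, ∑ j, if G.Adj i j then (x i - x j) ^ 2 else 0) / 2 := by
    rw [← Matrix.toLinearMap₂'_apply', SimpleGraph.lapMatrix_toLinearMap₂']
  have hdom : m * (x ⬝ᵥ G.lapMatrix ℝ *ᵥ x) ≤ 1 / 2 * ∑ i, ∑ j, max (a i j) 0 * (x i - x j) ^ 2 := by
    rw [hform]
    have h1 : m * ((∑ i, ∑ j, if G.Adj i j then (x i - x j) ^ 2 else 0) / 2)
        = 1 / 2 * ∑ i, ∑ j, m * (if G.Adj i j then (x i - x j) ^ 2 else 0) := by
      have : ∑ i, ∑ j, m * (if G.Adj i j then (x i - x j) ^ 2 else 0)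
          = m * ∑ i, ∑ j, (if G.Adj i j then (x i - x j) ^ 2 else 0) := by
        rw [Finset.mul_sum]
        exact Finset.sum_congr rfl fun i _ => by rw [Finset.mul_sum]
      rw [this]; ring
    rw [h1]
    refine mul_le_mul_of_nonneg_left (Finset.sum_le_sum fun i _ => Finset.sum_le_sum fun j _ => ?_)
      (by norm_num)
    by_cases hij : G.Adj i j
    · rw [if_pos hij]
      exact mul_le_mul_of_nonneg_right ((hm i j hij).trans (le_max_left _ _)) (sq_nonneg _)
    · rw [if_neg hij, mul_zero]
      exact mul_nonneg (le_max_right _ _) (sq_nonneg _)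
  calc m * μ₁ * (x ⬝ᵥ x) = m * (μ₁ * (x ⬝ᵥ x)) := by ring
    _ ≤ m * (x ⬝ᵥ G.lapMatrix ℝ *ᵥ x) := mul_le_mul_of_nonneg_left hMx hm0.le
    _ ≤ _ := hdom

omit [DecidableEq ι] in
/-- The homotopy weights `γᵢⱼ(t) = γᵢⱼ` (`γᵢⱼ > 0`), `t·γᵢⱼ` (`γᵢⱼ < 0`) have, for `t > 0`, the same
`Γ₊` and `Γ₋` as `γ`, and their form is `Q₊ − t·Q₋`. [cite: BronskiDeVille2014, §2.2 Definition 2.10 («`Γ(t) = Γ₊ + tΓ₋`», arXiv:1303.0718 p0007 L96–L106)] -/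
theorem form_homotopy (hw : ∀ i j, w i j = w j i) {t : ℝ} (ht : 0 < t) (x : ι → ℝ) :
    ∑ i, x i * ∑ j, (if w i j < 0 then t * w i j else w i j) * (x i - x j)
      = 1 / 2 * ∑ i, ∑ j, max (w i j) 0 * (x i - x j) ^ 2
        - t * (1 / 2 * ∑ i, ∑ j, max (-(w i j)) 0 * (x i - x j) ^ 2) := by
  have hwt : ∀ i j, (if w i j < 0 then t * w i j else w i j)
      = (if w j i < 0 then t * w j i else w j i) := fun i j => by rw [hw i j]
  have h1 : ∑ i, ∑ j, max (if w i j < 0 then t * w i j else w i j) 0 * (x i - x j) ^ 2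
      = ∑ i, ∑ j, max (w i j) 0 * (x i - x j) ^ 2 := by
    refine Finset.sum_congr rfl fun i _ => Finset.sum_congr rfl fun j _ => ?_
    by_cases h : w i j < 0
    · rw [if_pos h, max_eq_right (by nlinarith), max_eq_right h.le]
    · rw [if_neg h]
  have h2 : ∑ i, ∑ j, max (-(if w i j < 0 then t * w i j else w i j)) 0 * (x i - x j) ^ 2
      = t * ∑ i, ∑ j, max (-(w i j)) 0 * (x i - x j) ^ 2 := by
    rw [Finset.mul_sum]
    refine Finset.sum_congr rfl fun i _ => ?_
    rw [Finset.mul_sum]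
    refine Finset.sum_congr rfl fun j _ => ?_
    by_cases h : w i j < 0
    · rw [if_pos h, max_eq_left (by nlinarith), max_eq_left (by linarith)]; ring
    · rw [if_neg h, max_eq_right (by linarith)]; ring
  rw [form_eq_posPart_sub_negPart _ hwt x, h1, h2]
  ring

omit [Fintype ι] [DecidableEq ι] in
/-- For `t > 0` the homotopy weight is positive iff the original weight is. [folklore] -/
private theorem homotopy_pos_iff {t : ℝ} (ht : 0 < t) (i j : ι) :
    (0 < if w i j < 0 then t * w i j else w i j) ↔ 0 < w i j := by
  by_cases h : w i j < 0
  · rw [if_pos h]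
    constructor
    · intro h'; nlinarith
    · intro h'; linarith
  · rw [if_neg h]

omit [Fintype ι] [DecidableEq ι] in
/-- For `t > 0` the homotopy weight is negative iff the original weight is. [folklore] -/
private theorem homotopy_neg_iff {t : ℝ} (ht : 0 < t) (i j : ι) :
    ((if w i j < 0 then t * w i j else w i j) < 0) ↔ w i j < 0 := by
  by_cases h : w i j < 0
  · rw [if_pos h]
    exact ⟨fun _ => h, fun _ => by nlinarith⟩
  · rw [if_neg h]

omit [DecidableEq ι] in
/-- `x ≠ 0 ⇒ x ⬝ x > 0` over `ℝ`. [folklore] -/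
private theorem dotProduct_self_pos_of_ne_zero {x : ι → ℝ} (hx : x ≠ 0) : 0 < x ⬝ᵥ x := by
  have h0 : 0 ≤ x ⬝ᵥ x := Finset.sum_nonneg fun i _ => mul_self_nonneg (x i)
  exact h0.lt_of_ne fun h => hx (dotProduct_self_eq_zero.1 h.symm)

/-- ★★ **THEOREM 2.8, TIGHTNESS AT WEAK REPULSION**: «there exist open sets of weights giving
maximal number of negative eigenvalues `n₊(Γ) = c(Γ₊) − 1`, `n₋(Γ) = N − c(Γ₊)`, `n₀(Γ) = 1`» —
realised, as in the source's proof, along the homotopy `Γ(t) = Γ₊ + tΓ₋` of Definition 2.10: there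
is `t₀ > 0` such that for every `0 < t < t₀` every real symmetric matrix carrying the form of `Γ(t)`
(weights `γᵢⱼ` on `Γ₊`, `tγᵢⱼ` on `Γ₋`) has exactly this inertia.
[cite: BronskiDeVille2014, §2.2 Theorem 2.8 (tightness clause, first display) with Definition 2.10 and Lemma 2.16 (arXiv:1303.0718 p0007 L46–L60, L96–L106, p0009 L1–L25)] -/
theorem inertia_eq_of_weak_repulsion (hw : ∀ i j, w i j = w j i)
    (hGp : ∀ i j, Gp.Adj i j ↔ i ≠ j ∧ 0 < w i j) (hGm : ∀ i j, Gm.Adj i j ↔ i ≠ j ∧ w i j < 0)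
    (hconn : (Gp ⊔ Gm).Connected) :
    ∃ t₀ : ℝ, 0 < t₀ ∧ ∀ t : ℝ, 0 < t → t < t₀ →
      ∀ (W : Matrix ι ι ℝ) (hW : W.IsHermitian),
        (∀ x : ι → ℝ, x ⬝ᵥ W *ᵥ x
          = -∑ i, x i * ∑ j, (if w i j < 0 then t * w i j else w i j) * (x i - x j)) →
        (univ.filter fun i => 0 < hW.eigenvalues i).card = Nat.card Gp.ConnectedComponent - 1
          ∧ (univ.filter fun i => hW.eigenvalues i = 0).card = 1
          ∧ (univ.filter fun i => hW.eigenvalues i < 0).card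
              = Fintype.card ι - Nat.card Gp.ConnectedComponent := by
  classical
  haveI := hconn.nonempty
  obtain ⟨μ, hμ0, hμ⟩ := exists_gap Gp w fun i j hij => ((hGp i j).1 hij).2
  set Λ : ℝ := 2 * ∑ i, ∑ j, max (-(w i j)) 0 with hΛ
  have hΛ0 : 0 ≤ Λ := mul_nonneg (by norm_num)
    (Finset.sum_nonneg fun i _ => Finset.sum_nonneg fun j _ => le_max_right _ _)
  refine ⟨μ / (Λ + 1), div_pos hμ0 (by linarith), fun t ht0 ht W hW hWform => ?_⟩
  -- the homotopy has the same `Γ₊`, `Γ₋`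
  have hwt : ∀ i j, (if w i j < 0 then t * w i j else w i j)
      = (if w j i < 0 then t * w j i else w j i) := fun i j => by rw [hw i j]
  have hGpt : ∀ i j, Gp.Adj i j ↔ i ≠ j ∧ (0 < if w i j < 0 then t * w i j else w i j) :=
    fun i j => by rw [hGp, homotopy_pos_iff ht0]
  have hGmt : ∀ i j, Gm.Adj i j ↔ i ≠ j ∧ ((if w i j < 0 then t * w i j else w i j) < 0) :=
    fun i j => by rw [hGm, homotopy_neg_iff ht0]
  obtain ⟨⟨h1, -⟩, -, ⟨h5, -⟩⟩ := inertia_bounds hwt hGpt hGmt hconn hW hWform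
  have htot := card_pos_add_card_zero_add_card_neg hW
  -- the strict count: `#{λ ≥ 0} ≤ c(Γ₊)` for `t < t₀`
  set hM := SimpleGraph.isHermitian_lapMatrix ℝ Gp with hM_def
  let L : (ι → ℝ) →ₗ[ℝ] ({k // hM.eigenvalues k = 0} → ℝ) :=
    { toFun := fun x k => (hM.eigenvectorBasis k.1).ofLp ⬝ᵥ x
      map_add' := fun x y => by funext k; simp [dotProduct_add]
      map_smul' := fun r x => by funext k; simp [dotProduct_smul] }
  have hNN : (univ.filter fun i => 0 ≤ hW.eigenvalues i).card ≤ Nat.card Gp.ConnectedComponent := by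
    refine NonuniformKuramoto.card_eigenvalues_nonneg_le_of_neg_on_ker hW L ?_ fun x hx0 hx => ?_
    · rw [Module.finrank_fintype_fun_eq_card, card_eigenvalues_lapMatrix_eq_zero Gp]
    · have hcoord : ∀ k, hM.eigenvalues k = 0 → (hM.eigenvectorBasis k).ofLp ⬝ᵥ x = 0 :=
        fun k hk => congrFun hx ⟨k, hk⟩
      have hgap := hμ x hcoord
      have hneg := sumSq_le (fun i j => le_max_right (-(w i j)) 0) x
      rw [← hΛ] at hneg
      have hxx := dotProduct_self_pos_of_ne_zero hx0
      rw [hWform, form_homotopy hw ht0 x]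
      have htΛ : t * Λ < μ := by
        have h1 : t * (Λ + 1) < μ := by rwa [lt_div_iff₀ (by linarith)] at ht
        nlinarith
      have e1 : t * Λ * (x ⬝ᵥ x) < μ * (x ⬝ᵥ x) := mul_lt_mul_of_pos_right htΛ hxx
      have e2 : t * (1 / 2 * ∑ i, ∑ j, max (-(w i j)) 0 * (x i - x j) ^ 2) ≤ t * (Λ * (x ⬝ᵥ x)) :=
        mul_le_mul_of_nonneg_left hneg ht0.le
      nlinarith
  rw [card_nonneg_eq hW] at hNN
  have hc1 : 1 ≤ Nat.card Gp.ConnectedComponent := Nat.card_pos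
  omega

/-- ★★ **THEOREM 2.8, TIGHTNESS AT STRONG REPULSION**: «as well as open sets of weights giving the
maximal number of positive eigenvalues `n₊(Γ) = N − c(Γ₋)`, `n₋(Γ) = c(Γ₋) − 1`, `n₀(Γ) = 1`» —
along `Γ(t) = Γ₊ + tΓ₋` for all `t` beyond some `t₁` (Theorem 3.9: «Suppose that `t` is large and
positive. Then `ℒ(t)` has exactly `N − c(Γ₋)` negative [sic, for `ℒ(Γ₊) − tℒ(Γ₋)`] …»).
[cite: BronskiDeVille2014, §2.2 Theorem 2.8 (tightness clause, second display) with Definition 2.10, Lemma 2.15 and §3.2 Theorem 3.9 (arXiv:1303.0718 p0007 L46–L65, p0008 L98–L110, p0013)] -/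
theorem inertia_eq_of_strong_repulsion (hw : ∀ i j, w i j = w j i)
    (hGp : ∀ i j, Gp.Adj i j ↔ i ≠ j ∧ 0 < w i j) (hGm : ∀ i j, Gm.Adj i j ↔ i ≠ j ∧ w i j < 0)
    (hconn : (Gp ⊔ Gm).Connected) :
    ∃ t₁ : ℝ, 0 ≤ t₁ ∧ ∀ t : ℝ, t₁ < t →
      ∀ (W : Matrix ι ι ℝ) (hW : W.IsHermitian),
        (∀ x : ι → ℝ, x ⬝ᵥ W *ᵥ x
          = -∑ i, x i * ∑ j, (if w i j < 0 then t * w i j else w i j) * (x i - x j)) →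
        (univ.filter fun i => 0 < hW.eigenvalues i).card
            = Fintype.card ι - Nat.card Gm.ConnectedComponent
          ∧ (univ.filter fun i => hW.eigenvalues i = 0).card = 1
          ∧ (univ.filter fun i => hW.eigenvalues i < 0).card = Nat.card Gm.ConnectedComponent - 1 := by
  classical
  haveI := hconn.nonempty
  obtain ⟨μ, hμ0, hμ⟩ := exists_gap Gm (fun i j => -(w i j))
    fun i j hij => neg_pos.2 ((hGm i j).1 hij).2
  set Λ : ℝ := 2 * ∑ i, ∑ j, max (w i j) 0 with hΛ
  have hΛ0 : 0 ≤ Λ := mul_nonneg (by norm_num)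
    (Finset.sum_nonneg fun i _ => Finset.sum_nonneg fun j _ => le_max_right _ _)
  refine ⟨Λ / μ, div_nonneg hΛ0 hμ0.le, fun t ht W hW hWform => ?_⟩
  have ht0 : 0 < t := lt_of_le_of_lt (div_nonneg hΛ0 hμ0.le) ht
  have hwt : ∀ i j, (if w i j < 0 then t * w i j else w i j)
      = (if w j i < 0 then t * w j i else w j i) := fun i j => by rw [hw i j]
  have hGpt : ∀ i j, Gp.Adj i j ↔ i ≠ j ∧ (0 < if w i j < 0 then t * w i j else w i j) :=
    fun i j => by rw [hGp, homotopy_pos_iff ht0]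
  have hGmt : ∀ i j, Gm.Adj i j ↔ i ≠ j ∧ ((if w i j < 0 then t * w i j else w i j) < 0) :=
    fun i j => by rw [hGm, homotopy_neg_iff ht0]
  obtain ⟨-, ⟨h3, -⟩, ⟨h5, -⟩⟩ := inertia_bounds hwt hGpt hGmt hconn hW hWform
  have htot := card_pos_add_card_zero_add_card_neg hW
  set hM := SimpleGraph.isHermitian_lapMatrix ℝ Gm with hM_def
  let L : (ι → ℝ) →ₗ[ℝ] ({k // hM.eigenvalues k = 0} → ℝ) :=
    { toFun := fun x k => (hM.eigenvectorBasis k.1).ofLp ⬝ᵥ x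
      map_add' := fun x y => by funext k; simp [dotProduct_add]
      map_smul' := fun r x => by funext k; simp [dotProduct_smul] }
  have hNP : (univ.filter fun i => hW.eigenvalues i ≤ 0).card ≤ Nat.card Gm.ConnectedComponent := by
    refine NonuniformKuramoto.card_eigenvalues_nonpos_le_of_pos_on_ker hW L ?_ fun x hx0 hx => ?_
    · rw [Module.finrank_fintype_fun_eq_card, card_eigenvalues_lapMatrix_eq_zero Gm]
    · have hcoord : ∀ k, hM.eigenvalues k = 0 → (hM.eigenvectorBasis k).ofLp ⬝ᵥ x = 0 :=
        fun k hk => congrFun hx ⟨k, hk⟩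
      have hgap := hμ x hcoord
      have hpos := sumSq_le (fun i j => le_max_right (w i j) 0) x
      rw [← hΛ] at hpos
      have hxx := dotProduct_self_pos_of_ne_zero hx0
      rw [hWform, form_homotopy hw ht0 x]
      have htμ : Λ < t * μ := by rwa [div_lt_iff₀ hμ0] at ht
      have e1 : Λ * (x ⬝ᵥ x) < t * μ * (x ⬝ᵥ x) := mul_lt_mul_of_pos_right htμ hxx
      have e2 : t * (μ * (x ⬝ᵥ x)) ≤ t * (1 / 2 * ∑ i, ∑ j, max (-(w i j)) 0 * (x i - x j) ^ 2) :=
        mul_le_mul_of_nonneg_left hgap ht0.le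
      nlinarith
  rw [card_nonpos_eq hW] at hNP
  have hc1 : 1 ≤ Nat.card Gm.ConnectedComponent := Nat.card_pos
  omega

end Tight

end SignedLaplacian

/-! ### §4. THE MODEL: the type of ANY fixed point of a Kuramoto / droop oscillator network
(first-order) is pinned between `c(Γ₊) − 1` and `N − c(Γ₋)` -/

namespace NonuniformKuramoto

open Literature.LinearAlgebra.Matrix (refMinor refMinor_isHermitian)

variable {n : ℕ} (Kur : NonuniformKuramoto n)

/-- The stability matrix `−L(θ)` carries the signed-Laplacian form with weights
`wᵢⱼ = Pᵢⱼ cos(θᵢ − θⱼ)` (Bronski–DeVille's network reading: the Jacobian of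
`ẋᵢ = ωᵢ + Σⱼ φᵢⱼ(xⱼ − xᵢ)` «is a graph Laplacian» with `γᵢⱼ = φ′ᵢⱼ(xⱼ − xᵢ)`).
[cite: BronskiDeVille2014, §1 eqs. (network), (J) (arXiv:1303.0718 p0003 L45–L69)] -/
theorem neg_lap_form (θ x : Fin n → ℝ) :
    x ⬝ᵥ (-Kur.toDroopNetwork.lap θ) *ᵥ x
      = -∑ i, x i * ∑ j, (Kur.P i j * Real.cos (θ i - θ j)) * (x i - x j) := by
  rw [Matrix.neg_mulVec, dotProduct_neg, Kur.dotProduct_lap_mulVec]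
  simp only [toDroopNetwork_linWeight]

/-- The linearised weights `Pᵢⱼcos(θᵢ − θⱼ)` are symmetric for symmetric `P`. [folklore] -/
private theorem linWeights_symm (hP : ∀ i j, Kur.P i j = Kur.P j i) (θ : Fin n → ℝ) (i j : Fin n) :
    Kur.P i j * Real.cos (θ i - θ j) = Kur.P j i * Real.cos (θ j - θ i) := by
  rw [hP i j, ← Real.cos_neg, neg_sub]

/-- ★★★ **BRONSKI–DeVILLE'S BOUNDS FOR AN OSCILLATOR NETWORK AT ANY FIXED POINT.** MODEL: first-order
(non-uniform) Kuramoto / droop oscillators with symmetric coupling `P` on ANY topology, ANY natural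
frequencies and time constants, at ANY configuration `θ`; `Γ₊` = the graph of the pairs with
`Pᵢⱼcos(θᵢ − θⱼ) > 0` (the lines operated with `|θᵢ − θⱼ| < π/2` when `Pᵢⱼ > 0`), `Γ₋` = the pairs
with `Pᵢⱼcos(θᵢ − θⱼ) < 0` (the lines loaded beyond `π/2`), `Γ₊ ∪ Γ₋` connected, `c(·)` = number
of connected components (all `N` nodes counted). Then the symmetric stability matrix `−L(θ)`
(`= D·Jacobian`) has between `c(Γ₊) − 1` and `N − c(Γ₋)` POSITIVE eigenvalues, between `c(Γ₋) − 1`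
and `N − c(Γ₊)` negative ones, and the eigenvalue `0` with multiplicity between `1` and
`N + 2 − c(Γ₋) − c(Γ₊)`. [cite: BronskiDeVille2014, §1 eqs. (network), (J) and §2.2 Theorem 2.8 with Remarks 2.9 («a necessary condition for stability of a phase-locked state is that between any two oscillators there exists a path such `φ′ᵢⱼ(xᵢ − xⱼ) > 0` for all edges on the path») (arXiv:1303.0718 p0003 L45–L69, p0007 L35–L90)] -/
theorem inertia_bounds_neg_lap (hP : ∀ i j, Kur.P i j = Kur.P j i) (θ : Fin n → ℝ)
    {Gp Gm : SimpleGraph (Fin n)}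
    (hGp : ∀ i j, Gp.Adj i j ↔ i ≠ j ∧ 0 < Kur.P i j * Real.cos (θ i - θ j))
    (hGm : ∀ i j, Gm.Adj i j ↔ i ≠ j ∧ Kur.P i j * Real.cos (θ i - θ j) < 0)
    (hconn : (Gp ⊔ Gm).Connected) (hH : (-Kur.toDroopNetwork.lap θ).IsHermitian) :
    (Nat.card Gp.ConnectedComponent - 1 ≤ (univ.filter fun i => 0 < hH.eigenvalues i).card
        ∧ (univ.filter fun i => 0 < hH.eigenvalues i).card ≤ n - Nat.card Gm.ConnectedComponent)
      ∧ (Nat.card Gm.ConnectedComponent - 1 ≤ (univ.filter fun i => hH.eigenvalues i < 0).card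
        ∧ (univ.filter fun i => hH.eigenvalues i < 0).card ≤ n - Nat.card Gp.ConnectedComponent)
      ∧ (1 ≤ (univ.filter fun i => hH.eigenvalues i = 0).card
        ∧ (univ.filter fun i => hH.eigenvalues i = 0).card
            ≤ n + 2 - Nat.card Gm.ConnectedComponent - Nat.card Gp.ConnectedComponent) := by
  have h := SignedLaplacian.inertia_bounds (Kur.linWeights_symm hP θ) hGp hGm hconn hH
    (Kur.neg_lap_form θ)
  rwa [Fintype.card_fin] at h

/-- ★ **If `−L(θ)` has no positive eigenvalue (in particular at every Lyapunov-stable fixed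
point) the SHORT-LINE graph `Γ₊` is connected** — «between any two oscillators there exists a path
such `φ′ᵢⱼ(xᵢ − xⱼ) > 0` for all edges on the path». [cite: BronskiDeVille2014, §2.2 Remarks 2.9 (arXiv:1303.0718 p0007 L82–L90); DoBoccalettiGross2012, §III] -/
theorem shortLines_connected_of_card_pos_eq_zero (hP : ∀ i j, Kur.P i j = Kur.P j i)
    (θ : Fin n → ℝ) {Gp Gm : SimpleGraph (Fin n)}
    (hGp : ∀ i j, Gp.Adj i j ↔ i ≠ j ∧ 0 < Kur.P i j * Real.cos (θ i - θ j))
    (hGm : ∀ i j, Gm.Adj i j ↔ i ≠ j ∧ Kur.P i j * Real.cos (θ i - θ j) < 0)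
    (hconn : (Gp ⊔ Gm).Connected) (hH : (-Kur.toDroopNetwork.lap θ).IsHermitian)
    (hstable : (univ.filter fun i => 0 < hH.eigenvalues i).card = 0) : Gp.Connected :=
  SignedLaplacian.pos_connected_of_card_pos_eq_zero (Kur.linWeights_symm hP θ) hGp hGm hconn hH
    (Kur.neg_lap_form θ) hstable

/-- ★★★ **THE TYPE OF ANY (NON-DEGENERATE) FIXED POINT IS PINNED BY THE TWO COMPONENT COUNTS.**
Same model, `Dᵢ > 0`; at a configuration `θ` where the rotation is the only kernel direction of
`L(θ)` (`0` a simple eigenvalue — the generic case, «`n₀(Γ) = 1` on open sets») the Jacobian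
`−D⁻¹L(θ)` has — counting characteristic roots with multiplicity — AT LEAST `c(Γ₊) − 1` and AT MOST
`N − c(Γ₋)` roots in the open right half-plane, between `c(Γ₋) − 1` and `N − c(Γ₊)` roots in the
open left half-plane, and exactly one on the imaginary axis: a fixed point whose short lines leave
the network in `k` islands has type `≥ k − 1`; one whose long lines form a graph with `c(Γ₋)`
components has type `≤ N − c(Γ₋)`. [cite: BronskiDeVille2014, §2.2 Theorem 2.8 with Remarks 2.9 (arXiv:1303.0718 p0007 L35–L90); Chiang1995, §6 Theorem 6.7 (R1) (type = root count of the reduced system); ChenWangLiuBasarJohanssonQiu2016, §5 («J(θ₀) has exactly the same number of positive, negative, and zero eigenvalues as −L(θ₀)»)] -/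
theorem type_bounds_auxJac (hD : ∀ i, 0 < Kur.D i) (hP : ∀ i j, Kur.P i j = Kur.P j i)
    (θ : Fin n → ℝ) {Gp Gm : SimpleGraph (Fin n)}
    (hGp : ∀ i j, Gp.Adj i j ↔ i ≠ j ∧ 0 < Kur.P i j * Real.cos (θ i - θ j))
    (hGm : ∀ i j, Gm.Adj i j ↔ i ≠ j ∧ Kur.P i j * Real.cos (θ i - θ j) < 0)
    (hconn : (Gp ⊔ Gm).Connected) (hL : (Kur.toDroopNetwork.lap θ).IsHermitian)
    (hn0 : (univ.filter fun k => hL.eigenvalues k = 0).card = 1) :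
    (Nat.card Gp.ConnectedComponent - 1
          ≤ ((Kur.toDroopNetwork.auxJac θ).map (algebraMap ℝ ℂ)).charpoly.roots.countP
              (fun μ => 0 < μ.re)
        ∧ ((Kur.toDroopNetwork.auxJac θ).map (algebraMap ℝ ℂ)).charpoly.roots.countP
              (fun μ => 0 < μ.re) ≤ n - Nat.card Gm.ConnectedComponent)
      ∧ (Nat.card Gm.ConnectedComponent - 1
          ≤ ((Kur.toDroopNetwork.auxJac θ).map (algebraMap ℝ ℂ)).charpoly.roots.countP
              (fun μ => μ.re < 0)
        ∧ ((Kur.toDroopNetwork.auxJac θ).map (algebraMap ℝ ℂ)).charpoly.roots.countP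
              (fun μ => μ.re < 0) ≤ n - Nat.card Gp.ConnectedComponent)
      ∧ ((Kur.toDroopNetwork.auxJac θ).map (algebraMap ℝ ℂ)).charpoly.roots.countP
          (fun μ => μ.re = 0) = 1 := by
  classical
  have hH : (-Kur.toDroopNetwork.lap θ).IsHermitian := hL.neg
  obtain ⟨⟨h1, h2⟩, ⟨h3, h4⟩, -⟩ := Kur.inertia_bounds_neg_lap hP θ hGp hGm hconn hH
  have c1 := Literature.Analysis.Matrix.EigenvalueCountOnSubspaces.card_filter_eigenvalues_neg hL hH
    (fun x => 0 < x)
  have c3 := Literature.Analysis.Matrix.EigenvalueCountOnSubspaces.card_filter_eigenvalues_neg hL hH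
    (fun x => x < 0)
  simp only [neg_pos, neg_lt_zero] at c1 c3
  rw [c1] at h1 h2
  rw [c3] at h3 h4
  have hrow : ∀ i, ∑ l, Kur.toDroopNetwork.lap θ i l = 0 :=
    fun i => DroopNetwork.sum_lap_row (N := Kur.toDroopNetwork) θ i
  obtain ⟨i₀⟩ := hconn.nonempty
  have hHm := refMinor_isHermitian hL i₀
  obtain ⟨r1, r2, -, hreg⟩ := RefNode.refMinor_counts hL hrow hn0 i₀ hHm
  obtain ⟨t1, t2, t3⟩ := Kur.countP_roots_charpoly_toDroopNetwork_auxJac hP hD θ i₀ hHm hreg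
  rw [t1, t2, r1, r2]
  exact ⟨⟨h1, h2⟩, ⟨h3, h4⟩, t3⟩

/-- ★★ **RIGID CONFIGURATIONS (`c(Γ₊) + c(Γ₋) = N + 1`): the type is `c(Γ₊) − 1 = N − c(Γ₋)`
whatever the coupling strengths**, hypothesis-free (no simplicity assumption: rigidity forces the
simple zero). Trees (radial networks) are the case `c(Γ₊) = N − #E₊`, `c(Γ₋) = N − #E₋` of
`tree_type_auxJac`; a meshed example is a network whose long lines are bridges of `Γ₊ ∪ Γ₋` lying on
no cycle. [cite: BronskiDeVille2014, §2.1 Definition 2.1 (rigid) and §2.2 Remarks 2.9 («For rigid graphs there are no eigenvalue crossings and the index is fixed regardless of the choice of weights») (arXiv:1303.0718 p0006 L35–L40, p0007 L66–L75); Chiang1995, §6 Theorem 6.7 (R1)] -/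
theorem rigid_type_auxJac (hD : ∀ i, 0 < Kur.D i) (hP : ∀ i j, Kur.P i j = Kur.P j i)
    (θ : Fin n → ℝ) {Gp Gm : SimpleGraph (Fin n)}
    (hGp : ∀ i j, Gp.Adj i j ↔ i ≠ j ∧ 0 < Kur.P i j * Real.cos (θ i - θ j))
    (hGm : ∀ i j, Gm.Adj i j ↔ i ≠ j ∧ Kur.P i j * Real.cos (θ i - θ j) < 0)
    (hconn : (Gp ⊔ Gm).Connected)
    (hrigid : Nat.card Gp.ConnectedComponent + Nat.card Gm.ConnectedComponent = n + 1) :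
    ((Kur.toDroopNetwork.auxJac θ).map (algebraMap ℝ ℂ)).charpoly.roots.countP (fun μ => 0 < μ.re)
        = Nat.card Gp.ConnectedComponent - 1
      ∧ ((Kur.toDroopNetwork.auxJac θ).map (algebraMap ℝ ℂ)).charpoly.roots.countP
          (fun μ => μ.re < 0) = Nat.card Gm.ConnectedComponent - 1
      ∧ ((Kur.toDroopNetwork.auxJac θ).map (algebraMap ℝ ℂ)).charpoly.roots.countP
          (fun μ => μ.re = 0) = 1 := by
  classical
  have hL : (Kur.toDroopNetwork.lap θ).IsHermitian :=
    DroopNetwork.lap_isHermitian (N := Kur.toDroopNetwork) (fun i j => hP i j) θ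
  have hH : (-Kur.toDroopNetwork.lap θ).IsHermitian := hL.neg
  have hrigid' : Nat.card Gp.ConnectedComponent + Nat.card Gm.ConnectedComponent
      = Fintype.card (Fin n) + 1 := by rw [Fintype.card_fin]; exact hrigid
  obtain ⟨h1, h2, h3⟩ := SignedLaplacian.rigid_inertia (Kur.linWeights_symm hP θ) hGp hGm hconn
    hrigid' hH (Kur.neg_lap_form θ)
  have c1 := Literature.Analysis.Matrix.EigenvalueCountOnSubspaces.card_filter_eigenvalues_neg hL hH
    (fun x => 0 < x)
  have c2 := Literature.Analysis.Matrix.EigenvalueCountOnSubspaces.card_filter_eigenvalues_neg hL hH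
    (fun x => x = 0)
  have c3 := Literature.Analysis.Matrix.EigenvalueCountOnSubspaces.card_filter_eigenvalues_neg hL hH
    (fun x => x < 0)
  simp only [neg_pos, neg_eq_zero, neg_lt_zero] at c1 c2 c3
  rw [c1] at h1; rw [c2] at h2; rw [c3] at h3
  have hrow : ∀ i, ∑ l, Kur.toDroopNetwork.lap θ i l = 0 :=
    fun i => DroopNetwork.sum_lap_row (N := Kur.toDroopNetwork) θ i
  obtain ⟨i₀⟩ := hconn.nonempty
  have hHm := refMinor_isHermitian hL i₀
  obtain ⟨r1, r2, -, hreg⟩ := RefNode.refMinor_counts hL hrow h2 i₀ hHm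
  obtain ⟨t1, t2, t3⟩ := Kur.countP_roots_charpoly_toDroopNetwork_auxJac hP hD θ i₀ hHm hreg
  refine ⟨?_, ?_, t3⟩
  · rw [t1, r2, h1]
  · rw [t2, r1, h3]

/-- ★ **TIGHTNESS IN THE MODEL (weak repulsion):** keep `θ` and the short lines, and scale the
couplings of the long lines (`Pᵢⱼcos(θᵢ − θⱼ) < 0`) by a common factor `t`; then for all
sufficiently small `t > 0` the fixed point `θ` of the rescaled network has type EXACTLY
`c(Γ₊) − 1`, `N − c(Γ₊)` roots in the open left half-plane and a simple axis root — the lower type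
bound is attained (Bronski–DeVille's homotopy `Γ(t) = Γ₊ + tΓ₋`).
[cite: BronskiDeVille2014, §2.2 Theorem 2.8 (tightness clause) with Definition 2.10 (arXiv:1303.0718 p0007 L46–L60, L96–L106); Chiang1995, §6 Theorem 6.7 (R1)] -/
theorem type_eq_of_weak_longLines (hP : ∀ i j, Kur.P i j = Kur.P j i) (θ : Fin n → ℝ)
    {Gp Gm : SimpleGraph (Fin n)}
    (hGp : ∀ i j, Gp.Adj i j ↔ i ≠ j ∧ 0 < Kur.P i j * Real.cos (θ i - θ j))
    (hGm : ∀ i j, Gm.Adj i j ↔ i ≠ j ∧ Kur.P i j * Real.cos (θ i - θ j) < 0)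
    (hconn : (Gp ⊔ Gm).Connected) :
    ∃ t₀ : ℝ, 0 < t₀ ∧ ∀ t : ℝ, 0 < t → t < t₀ → ∀ Kur' : NonuniformKuramoto n,
      (∀ i, 0 < Kur'.D i) →
      (∀ i j, Kur'.P i j
        = (if Kur.P i j * Real.cos (θ i - θ j) < 0 then t else 1) * Kur.P i j) →
      ((Kur'.toDroopNetwork.auxJac θ).map (algebraMap ℝ ℂ)).charpoly.roots.countP (fun μ => 0 < μ.re)
          = Nat.card Gp.ConnectedComponent - 1
        ∧ ((Kur'.toDroopNetwork.auxJac θ).map (algebraMap ℝ ℂ)).charpoly.roots.countP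
            (fun μ => μ.re < 0) = n - Nat.card Gp.ConnectedComponent
        ∧ ((Kur'.toDroopNetwork.auxJac θ).map (algebraMap ℝ ℂ)).charpoly.roots.countP
            (fun μ => μ.re = 0) = 1 := by
  classical
  obtain ⟨t₀, ht₀, hmain⟩ := SignedLaplacian.inertia_eq_of_weak_repulsion
    (Kur.linWeights_symm hP θ) hGp hGm hconn
  refine ⟨t₀, ht₀, fun t ht0 ht Kur' hD' hP' => ?_⟩
  have hPs' : ∀ i j, Kur'.P i j = Kur'.P j i := by
    intro i j
    rw [hP' i j, hP' j i, Kur.linWeights_symm hP θ i j, hP i j]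
  have hL : (Kur'.toDroopNetwork.lap θ).IsHermitian :=
    DroopNetwork.lap_isHermitian (N := Kur'.toDroopNetwork) (fun i j => hPs' i j) θ
  have hH : (-Kur'.toDroopNetwork.lap θ).IsHermitian := hL.neg
  have hform : ∀ x : Fin n → ℝ, x ⬝ᵥ (-Kur'.toDroopNetwork.lap θ) *ᵥ x
      = -∑ i, x i * ∑ j, (if Kur.P i j * Real.cos (θ i - θ j) < 0
          then t * (Kur.P i j * Real.cos (θ i - θ j)) else Kur.P i j * Real.cos (θ i - θ j))
            * (x i - x j) := by
    intro x
    rw [Kur'.neg_lap_form θ x]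
    congr 1
    refine Finset.sum_congr rfl fun i _ => ?_
    congr 1
    refine Finset.sum_congr rfl fun j _ => ?_
    rw [hP' i j]
    split_ifs <;> ring
  obtain ⟨h1, h2, h3⟩ := hmain t ht0 ht _ hH hform
  have c1 := Literature.Analysis.Matrix.EigenvalueCountOnSubspaces.card_filter_eigenvalues_neg hL hH
    (fun x => 0 < x)
  have c2 := Literature.Analysis.Matrix.EigenvalueCountOnSubspaces.card_filter_eigenvalues_neg hL hH
    (fun x => x = 0)
  have c3 := Literature.Analysis.Matrix.EigenvalueCountOnSubspaces.card_filter_eigenvalues_neg hL hH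
    (fun x => x < 0)
  simp only [neg_pos, neg_eq_zero, neg_lt_zero] at c1 c2 c3
  rw [c1] at h1; rw [c2] at h2; rw [c3, Fintype.card_fin] at h3
  have hrow : ∀ i, ∑ l, Kur'.toDroopNetwork.lap θ i l = 0 :=
    fun i => DroopNetwork.sum_lap_row (N := Kur'.toDroopNetwork) θ i
  obtain ⟨i₀⟩ := hconn.nonempty
  have hHm := refMinor_isHermitian hL i₀
  obtain ⟨r1, r2, -, hreg⟩ := RefNode.refMinor_counts hL hrow h2 i₀ hHm
  obtain ⟨t1, t2, t3⟩ := Kur'.countP_roots_charpoly_toDroopNetwork_auxJac hPs' hD' θ i₀ hHm hreg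
  refine ⟨?_, ?_, t3⟩
  · rw [t1, r2, h1]
  · rw [t2, r1, h3]

/-- ★ **TIGHTNESS IN THE MODEL (strong repulsion):** scaling the couplings of the long lines by any
sufficiently LARGE factor `t` makes the type EXACTLY `N − c(Γ₋)` (the upper bound), with
`c(Γ₋) − 1` roots in the open left half-plane and a simple axis root.
[cite: BronskiDeVille2014, §2.2 Theorem 2.8 (tightness clause) with Definition 2.10 and §3.2 Theorem 3.9 (arXiv:1303.0718 p0007 L46–L65, p0013); Chiang1995, §6 Theorem 6.7 (R1)] -/
theorem type_eq_of_strong_longLines (hP : ∀ i j, Kur.P i j = Kur.P j i) (θ : Fin n → ℝ)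
    {Gp Gm : SimpleGraph (Fin n)}
    (hGp : ∀ i j, Gp.Adj i j ↔ i ≠ j ∧ 0 < Kur.P i j * Real.cos (θ i - θ j))
    (hGm : ∀ i j, Gm.Adj i j ↔ i ≠ j ∧ Kur.P i j * Real.cos (θ i - θ j) < 0)
    (hconn : (Gp ⊔ Gm).Connected) :
    ∃ t₁ : ℝ, 0 ≤ t₁ ∧ ∀ t : ℝ, t₁ < t → ∀ Kur' : NonuniformKuramoto n,
      (∀ i, 0 < Kur'.D i) →
      (∀ i j, Kur'.P i j
        = (if Kur.P i j * Real.cos (θ i - θ j) < 0 then t else 1) * Kur.P i j) →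
      ((Kur'.toDroopNetwork.auxJac θ).map (algebraMap ℝ ℂ)).charpoly.roots.countP (fun μ => 0 < μ.re)
          = n - Nat.card Gm.ConnectedComponent
        ∧ ((Kur'.toDroopNetwork.auxJac θ).map (algebraMap ℝ ℂ)).charpoly.roots.countP
            (fun μ => μ.re < 0) = Nat.card Gm.ConnectedComponent - 1
        ∧ ((Kur'.toDroopNetwork.auxJac θ).map (algebraMap ℝ ℂ)).charpoly.roots.countP
            (fun μ => μ.re = 0) = 1 := by
  classical
  obtain ⟨t₁, ht₁, hmain⟩ := SignedLaplacian.inertia_eq_of_strong_repulsion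
    (Kur.linWeights_symm hP θ) hGp hGm hconn
  refine ⟨t₁, ht₁, fun t ht Kur' hD' hP' => ?_⟩
  have hPs' : ∀ i j, Kur'.P i j = Kur'.P j i := by
    intro i j
    rw [hP' i j, hP' j i, Kur.linWeights_symm hP θ i j, hP i j]
  have hL : (Kur'.toDroopNetwork.lap θ).IsHermitian :=
    DroopNetwork.lap_isHermitian (N := Kur'.toDroopNetwork) (fun i j => hPs' i j) θ
  have hH : (-Kur'.toDroopNetwork.lap θ).IsHermitian := hL.neg
  have hform : ∀ x : Fin n → ℝ, x ⬝ᵥ (-Kur'.toDroopNetwork.lap θ) *ᵥ x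
      = -∑ i, x i * ∑ j, (if Kur.P i j * Real.cos (θ i - θ j) < 0
          then t * (Kur.P i j * Real.cos (θ i - θ j)) else Kur.P i j * Real.cos (θ i - θ j))
            * (x i - x j) := by
    intro x
    rw [Kur'.neg_lap_form θ x]
    congr 1
    refine Finset.sum_congr rfl fun i _ => ?_
    congr 1
    refine Finset.sum_congr rfl fun j _ => ?_
    rw [hP' i j]
    split_ifs <;> ring
  obtain ⟨h1, h2, h3⟩ := hmain t ht _ hH hform
  have c1 := Literature.Analysis.Matrix.EigenvalueCountOnSubspaces.card_filter_eigenvalues_neg hL hH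
    (fun x => 0 < x)
  have c2 := Literature.Analysis.Matrix.EigenvalueCountOnSubspaces.card_filter_eigenvalues_neg hL hH
    (fun x => x = 0)
  have c3 := Literature.Analysis.Matrix.EigenvalueCountOnSubspaces.card_filter_eigenvalues_neg hL hH
    (fun x => x < 0)
  simp only [neg_pos, neg_eq_zero, neg_lt_zero] at c1 c2 c3
  rw [c1, Fintype.card_fin] at h1; rw [c2] at h2; rw [c3] at h3
  have hrow : ∀ i, ∑ l, Kur'.toDroopNetwork.lap θ i l = 0 :=
    fun i => DroopNetwork.sum_lap_row (N := Kur'.toDroopNetwork) θ i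
  obtain ⟨i₀⟩ := hconn.nonempty
  have hHm := refMinor_isHermitian hL i₀
  obtain ⟨r1, r2, -, hreg⟩ := RefNode.refMinor_counts hL hrow h2 i₀ hHm
  obtain ⟨t1, t2, t3⟩ := Kur'.countP_roots_charpoly_toDroopNetwork_auxJac hPs' hD' θ i₀ hHm hreg
  refine ⟨?_, ?_, t3⟩
  · rw [t1, r2, h1]
  · rw [t2, r1, h3]

end NonuniformKuramoto

/-! ### §5. THE MODEL, swing tier: the same bounds for the synchronous states of the classical
(network-reduced, lossless) swing equations -/

namespace ClassicalModel

namespace LosslessSystem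

open Literature.LinearAlgebra.Matrix (refMinor refMinor_isHermitian)

variable {n : ℕ} (S : LosslessSystem n 0)

/-- ★★★ **THE TYPE OF ANY (NON-DEGENERATE) SYNCHRONOUS STATE OF THE CLASSICAL SWING MODEL IS
PINNED BY THE TWO COMPONENT COUNTS.** MODEL: network-reduced lossless swing equations
`Mᵢδ̈ᵢ + Dᵢδ̇ᵢ = Pᵢ − Σⱼ Cᵢⱼ sin(δᵢ − δⱼ)`, `C` symmetric, `Mᵢ, Dᵢ > 0`, any injections, ANY topology;
at a configuration `θ` with `Γ₊` / `Γ₋` the pairs of positive / negative `Cᵢⱼcos(θᵢ − θⱼ)`,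
`Γ₊ ∪ Γ₋` connected and `0` a simple eigenvalue of the Hesse matrix `M(θ)`: the swing Jacobian at
`(θ, 0)` has between `c(Γ₊) − 1` and `N − c(Γ₋)` characteristic roots in the open right half-plane,
between `c(Γ₋) − 1 + N` and `2N − c(Γ₊)` in the open left half-plane, exactly one on the axis
(Chiang's Theorem 6.1: type of `(δ, 0)` = index of the Hessian). [cite: BronskiDeVille2014, §2.2 Theorem 2.8 with Remarks 2.9 (arXiv:1303.0718 p0007 L35–L90); Chiang1995, §6.3 Theorem 6.1 («static relationship») and §6.1 eq. (6.2); ManikTimmeWitthaut2017, §3 Lemma 1 («for both the Kuramoto system and the power grid model»)] -/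
theorem type_bounds_phaseJac (hM : ∀ i, 0 < S.M i) (hD : ∀ i, 0 < S.D i)
    (hC : ∀ i j, S.C i j = S.C j i) (θ : Fin n → ℝ) {Gp Gm : SimpleGraph (Fin n)}
    (hGp : ∀ i j, Gp.Adj i j ↔ i ≠ j ∧ 0 < S.C i j * Real.cos (θ i - θ j))
    (hGm : ∀ i j, Gm.Adj i j ↔ i ≠ j ∧ S.C i j * Real.cos (θ i - θ j) < 0)
    (hconn : (Gp ⊔ Gm).Connected) (hHess : (S.hessMatrix θ).IsHermitian)
    (hn0 : (univ.filter fun k => hHess.eigenvalues k = 0).card = 1) :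
    (Nat.card Gp.ConnectedComponent - 1
          ≤ ((S.phaseJac θ).map (algebraMap ℝ ℂ)).charpoly.roots.countP (fun μ => 0 < μ.re)
        ∧ ((S.phaseJac θ).map (algebraMap ℝ ℂ)).charpoly.roots.countP (fun μ => 0 < μ.re)
          ≤ n - Nat.card Gm.ConnectedComponent)
      ∧ (Nat.card Gm.ConnectedComponent - 1 + n
          ≤ ((S.phaseJac θ).map (algebraMap ℝ ℂ)).charpoly.roots.countP (fun μ => μ.re < 0)
        ∧ ((S.phaseJac θ).map (algebraMap ℝ ℂ)).charpoly.roots.countP (fun μ => μ.re < 0)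
          ≤ n - Nat.card Gp.ConnectedComponent + n)
      ∧ ((S.phaseJac θ).map (algebraMap ℝ ℂ)).charpoly.roots.countP (fun μ => μ.re = 0) = 1 := by
  classical
  have hH : (-S.hessMatrix θ).IsHermitian := hHess.neg
  have hw : ∀ i j, S.C i j * Real.cos (θ i - θ j) = S.C j i * Real.cos (θ j - θ i) := by
    intro i j; rw [hC i j, ← Real.cos_neg, neg_sub]
  have hform : ∀ x : Fin n → ℝ, x ⬝ᵥ (-S.hessMatrix θ) *ᵥ x
      = -∑ i, x i * ∑ j, (S.C i j * Real.cos (θ i - θ j)) * (x i - x j) := by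
    intro x
    rw [Matrix.neg_mulVec, dotProduct_neg, S.hessMatrix_form θ x]
  obtain ⟨⟨h1, h2⟩, ⟨h3, h4⟩, -⟩ := SignedLaplacian.inertia_bounds hw hGp hGm hconn hH hform
  rw [Fintype.card_fin] at h2 h4
  have c1 := Literature.Analysis.Matrix.EigenvalueCountOnSubspaces.card_filter_eigenvalues_neg
    hHess hH (fun x => 0 < x)
  have c3 := Literature.Analysis.Matrix.EigenvalueCountOnSubspaces.card_filter_eigenvalues_neg
    hHess hH (fun x => x < 0)
  simp only [neg_pos, neg_lt_zero] at c1 c3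
  rw [c1] at h1 h2
  rw [c3] at h3 h4
  have hrow : ∀ i, ∑ l, S.hessMatrix θ i l = 0 := fun i => sum_hessMatrix_row S θ i
  obtain ⟨i₀⟩ := hconn.nonempty
  have hHm := refMinor_isHermitian hHess i₀
  obtain ⟨r1, r2, -, hreg⟩ := RefNode.refMinor_counts hHess hrow hn0 i₀ hHm
  obtain ⟨t1, t2, t3⟩ := S.countP_roots_charpoly_phaseJac_modRotation hM hD hC θ i₀ hHm hreg
  rw [t1, t2, r1, r2]
  exact ⟨⟨h1, h2⟩, ⟨by omega, by omega⟩, t3⟩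

/-- ★★ **RIGID CONFIGURATIONS of the swing model (`c(Γ₊) + c(Γ₋) = N + 1`): type exactly
`c(Γ₊) − 1`**, `c(Γ₋) − 1 + N` roots in the open left half-plane, one on the axis — no simplicity
hypothesis. [cite: BronskiDeVille2014, §2.2 Remarks 2.9 (rigid graphs) (arXiv:1303.0718 p0007 L66–L75); Chiang1995, §6.3 Theorem 6.1] -/
theorem rigid_type_phaseJac (hM : ∀ i, 0 < S.M i) (hD : ∀ i, 0 < S.D i)
    (hC : ∀ i j, S.C i j = S.C j i) (θ : Fin n → ℝ) {Gp Gm : SimpleGraph (Fin n)}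
    (hGp : ∀ i j, Gp.Adj i j ↔ i ≠ j ∧ 0 < S.C i j * Real.cos (θ i - θ j))
    (hGm : ∀ i j, Gm.Adj i j ↔ i ≠ j ∧ S.C i j * Real.cos (θ i - θ j) < 0)
    (hconn : (Gp ⊔ Gm).Connected)
    (hrigid : Nat.card Gp.ConnectedComponent + Nat.card Gm.ConnectedComponent = n + 1) :
    ((S.phaseJac θ).map (algebraMap ℝ ℂ)).charpoly.roots.countP (fun μ => 0 < μ.re)
        = Nat.card Gp.ConnectedComponent - 1
      ∧ ((S.phaseJac θ).map (algebraMap ℝ ℂ)).charpoly.roots.countP (fun μ => μ.re < 0)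
        = Nat.card Gm.ConnectedComponent - 1 + n
      ∧ ((S.phaseJac θ).map (algebraMap ℝ ℂ)).charpoly.roots.countP (fun μ => μ.re = 0) = 1 := by
  classical
  have hHess : (S.hessMatrix θ).IsHermitian := S.hessMatrix_isHermitian hC θ
  have hH : (-S.hessMatrix θ).IsHermitian := hHess.neg
  have hw : ∀ i j, S.C i j * Real.cos (θ i - θ j) = S.C j i * Real.cos (θ j - θ i) := by
    intro i j; rw [hC i j, ← Real.cos_neg, neg_sub]
  have hform : ∀ x : Fin n → ℝ, x ⬝ᵥ (-S.hessMatrix θ) *ᵥ x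
      = -∑ i, x i * ∑ j, (S.C i j * Real.cos (θ i - θ j)) * (x i - x j) := by
    intro x
    rw [Matrix.neg_mulVec, dotProduct_neg, S.hessMatrix_form θ x]
  have hrigid' : Nat.card Gp.ConnectedComponent + Nat.card Gm.ConnectedComponent
      = Fintype.card (Fin n) + 1 := by rw [Fintype.card_fin]; exact hrigid
  obtain ⟨h1, h2, h3⟩ := SignedLaplacian.rigid_inertia hw hGp hGm hconn hrigid' hH hform
  have c1 := Literature.Analysis.Matrix.EigenvalueCountOnSubspaces.card_filter_eigenvalues_neg
    hHess hH (fun x => 0 < x)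
  have c2 := Literature.Analysis.Matrix.EigenvalueCountOnSubspaces.card_filter_eigenvalues_neg
    hHess hH (fun x => x = 0)
  have c3 := Literature.Analysis.Matrix.EigenvalueCountOnSubspaces.card_filter_eigenvalues_neg
    hHess hH (fun x => x < 0)
  simp only [neg_pos, neg_eq_zero, neg_lt_zero] at c1 c2 c3
  rw [c1] at h1; rw [c2] at h2; rw [c3] at h3
  have hrow : ∀ i, ∑ l, S.hessMatrix θ i l = 0 := fun i => sum_hessMatrix_row S θ i
  obtain ⟨i₀⟩ := hconn.nonempty
  have hHm := refMinor_isHermitian hHess i₀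
  obtain ⟨r1, r2, -, hreg⟩ := RefNode.refMinor_counts hHess hrow h2 i₀ hHm
  obtain ⟨t1, t2, t3⟩ := S.countP_roots_charpoly_phaseJac_modRotation hM hD hC θ i₀ hHm hreg
  refine ⟨?_, ?_, t3⟩
  · rw [t1, r2, h1]
  · rw [t2, r1, h3]

end LosslessSystem

end ClassicalModel

end Literature.MathematicalPhysics.PowerSystems

end
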